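import Summits.QuantumFields.YangMills.Theses.ParabolicTrajectory
import Literature.MathematicalPhysics.QuantumFieldTheory.LatticeGaugeProofs
import Literature.Probability.LatticeModels.ProductMeasureTools

/-!
# Disproof of `TunedSequenceExists` — standing adversary file (cdisprove, gens 2–3)

Crux item `stmt-QuantumFields-10524`, decl
`Summit.QuantumFields.YangMills.Theses.ParabolicTrajectory.TunedSequenceExists` ((S) of route
ParabolicTrajectory): for every compact simple Lie `G`, faithful unitary `r`, `M ≥ 2` there is a
window `(0, θ₀)` such that every `θ` in it is the limit of the rescaled connected curvature
two-point function `N_1(k) = (M^{n_k})^8 ⟨P ; τ_{M^{n_k}} P⟩_{β_k, 2L_k+1}` along SOME `M`-adic Wilson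
scheme with `β_k → ∞`, all `N_t(k)`, `t ≥ 1`, converging.

## Findings (index; every `theorem` below is sorry-free unless it sits in § NearMisses)

* § Scheme / § Shape — `Window r M` is the crux body at fixed `(G, r, M)`
  (`tunedSequenceExists_iff`, `Iff.rfl`); consequences of the shape clause:
  `tendsto_pow_of_shape` (`M^{n_k} → ∞`), `tendsto_exponent_of_shape` (`n_k → ∞`),
  `eventually_sep_le_L` (no wrap-around: `t M^{n_k} ≤ L_k` eventually).
* § LoadBearing — `not_window_one`, `not_window_zero` (the clause `2 ≤ M` is load-bearing for EVERY
  `G, r`: `M = 0, 1` make the shape clause contradict `SpeciesScheme.tendsto_a`);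
  `not_window_of_subsingleton` (for the trivial group every connected correlator vanishes, so the
  non-abelian clause inside `IsCompactSimpleLieGroup` is load-bearing) and the global corollary
  `not_tunedSequenceExistsWithoutSimple`.
* § ClauseThree — NEW: `window_iff_windowBdd`: clause (iii) (convergence of every `N_t`) may be
  replaced by mere BOUNDEDNESS of every `N_t` (diagonal subsequence + re-indexed scheme
  `reindex`); so the only content of (iii) beyond (iv) is an a-priori bound on `N_t, t ≥ 2` along
  the tuned sequence (physically `0 ≤ N_t ≤ N_1`, transfer-operator positivity; NOT available
  from the tree's reflection positivity, which is even-side while `sch.side = 2L+1`);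
  `CorrMonotone` (positivity + monotone decay in the separation within the half torus) is the
  exact RP-type input: `aprioriBound_of_corrMonotone`, `window_iff_windowWeak_of_corrMonotone`.
* § Freezing — `tendsto_laplaceAverage` (abstract Laplace concentration on a compact space),
  `integral_wilsonMeasure_eq_div`, `latticeConnectedCorr_curvature_tendsto_zero` (FIXED torus and
  separation: `⟨P ; τ_m P⟩_β → 0` as `β → ∞`, every compact `G`, every unitary `r`);
  NEW strengthening kill `exists_beta_ceiling` / `not_windowDominating`: there is a ceiling
  `b(m, L)` such that every tuned witness has `β_k < b(n_k, L_k)` eventually — the coupling cannot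
  be sent to infinity independently of the lattice data (so "`β_k → ∞`" in (S) is a TUNED
  divergence, pinned between the strong-coupling floor and this ceiling).
* § BetaZero — `wilsonMeasure_zero` (β = 0 is product Haar), `latticeConnectedCorr_zero_of_disjoint`
  (torus-disjoint cylinder observables are uncorrelated at β = 0),
  `latticeConnectedCorr_curvature_zero` (`⟨P ; τ_m P⟩_{0, S} = 0` for `2 ≤ m ≤ S - 2`: the IVT
  lower endpoint), `not_windowAtZero` (the clause `β_k → ∞` cannot be replaced by `β_k = 0`).
* § Glue — `continuous_laplaceIntegral`, `continuous_integral_wilsonMeasure`,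
  `continuous_latticeConnectedCorr_curvature` (β-continuity on a fixed torus, dominated
  convergence); `exists_ge_corr_eq` (IVT: exact tuning beyond any point where the correlator is
  large); `CorrelatorWindowLowerBound` (finite-volume quantitative `ξ(β) → ∞`, the open input) and
  `windowWeak_iff_lowerBound : WindowWeak r M ↔ CorrelatorWindowLowerBound r M` (`M ≥ 2`);
  `window_of_lowerBound_of_aprioriBound`, `lowerBound_of_window`,
  `lowerBound_of_tunedSequenceExists`. NET DISSECTION: crux body = (open lower bound) +
  (a-priori bound on `N_t`, `t ≥ 2`); a refutation of the crux = a refutation of the finite-volume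
  quantitative `ξ(β) → ∞` for one `(G, r, M)`.
* § Uniform — `not_window_uniform` (`∀ θ ∃ scheme` cannot become `∃ scheme ∀ θ`),
  `abs_latticeConnectedCorr_le` (the only unconditional a-priori bound, `2 C_A C_B`).
* § ClauseThree (gen 3 addendum) — `CorrMonotoneNonneg` (the RP-type input restricted to `β ≥ 0`,
  which is all that is usable — link RP needs `β ≥ 0` — and all that is needed since `β_k → ∞`):
  `aprioriBound_of_corrMonotoneNonneg`, `window_iff_windowWeak_of_corrMonotoneNonneg`.
* § Exponent (gen 3) — `WindowWeakPow r M p` / `LowerBoundPow r M p` (exponent `8 ↦ p`):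
  `windowWeakPow_iff_lowerBoundPow` (every `p`), `lowerBoundPow_mono`, `windowWeakPow_mono`,
  `windowWeakPow_of_window` (`p ≥ 8`): the canonical power is NOT load-bearing from above — the
  crux implies all its `p ≥ 8` weak variants (their witnesses drift to the Gaussian end); refuting
  `p < 8` would need a canonical-scaling upper bound (UV stability of `tr F²`), not in the tree.
* § Clustering (gen 3) — `UniformClustering r` (rate `m > 0`, amplitude `C`, uniform over
  `β ≥ β₁`, all tori, `D ≤ L`): `not_windowWeak_of_uniformClustering`,
  `not_window_of_uniformClustering`, `not_lowerBound_of_uniformClustering`,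
  `not_uniformClustering_of_tunedSequenceExists`, and the thresholded form
  `UniformClusteringBeyond` (bound only for `L ≥ c₀ D`, as expansions deliver it) with
  `not_window_of_uniformClusteringBeyond` — the crux implies that NO compact simple
  lattice gauge theory clusters uniformly at weak coupling (lattice `ξ(β)` unbounded on every
  `[β₁, ∞)`: the honest negation target of (S), and the formal content of the finite-group /
  `DiscreteSubgroupFreezing` obstruction — `ConnectedSpace G` is load-bearing modulo the textbook
  low-temperature expansion).
* § Faithful (gen 3) — `WindowRho ρ M` (crux body over a bare continuous unitary `ρ`;
  `windowRho_iff_window`), `latticeConnectedCorr_actionDensity_one`, `not_windowRho_one`,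
  `not_tunedSequenceExistsUnfaithful[_of]`: faithfulness (non-triviality) of the representation
  datum is load-bearing (trivial character ⇒ `N_1 ≡ 0`).
* § FiniteGroups (gen 3, UNCONDITIONAL) — `not_window_of_finite_abelian` (every finite abelian
  non-trivial `G`, faithful unitary `r`, every `M`: the window is EMPTY — tree's Kotecký–Preiss
  contour expansion re-assembled with β-uniform constants, landed as
  `Negative.FiniteAbelianClustering` + `Negative.FiniteGroupFalse`), `TunedSequenceExistsNontrivial`,
  `not_tunedSequenceExistsNontrivial` (witness `ℤ₂`): `IsCompactSimpleLieGroup ↛ Nontrivial`.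
* § FiniteGroups (gen 3, UNCONDITIONAL; theorems in the landed `Negative.FiniteGroupFalse` /
  `Negative.FiniteAbelianClustering`) — every finite abelian non-trivial `G`, faithful unitary
  `r`, every `M`: the window is EMPTY (tree's Kotecký–Preiss contour expansion with β-uniform
  constants); `TunedSequenceExistsNontrivial` (refuted there, witness `ℤ₂`):
  `IsCompactSimpleLieGroup ↛ Nontrivial`.
* § Madic (gen 3) — `window_of_window_pow : Window r (M^j) → Window r M`, `not_window_pow`.
* § Resists — why no refutation of (S) itself is in reach (docblock at the end), warnings for
  provers, the exact open input, and (gen 3) why no `kit` computation was run.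

Gen-1's evidence file (`20260815T223832Z-Disproof.lean`, 1330 lines: β = 0 exact vanishing,
fixed-coupling kill under uniform clustering, continuity in β, IVT root lemmas,
`CorrelatorWindowLowerBound` ⟺ crux-minus-(iii)) is not readable from refuter jails (run/gate is
not mounted); this file is self-contained and is published with `ledger crux write` so that
successors can `ledger crux cat stmt-QuantumFields-10524 Disproof.lean`.
-/

noncomputable section

open Filter Topology MeasureTheory
open Literature.MathematicalPhysics.QuantumFieldTheory Literature.MathematicalPhysics.QuantumLattice
open Summit.QuantumFields.YangMills.Theses.ParabolicTrajectory (TunedSequenceExists)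

namespace Summit.QuantumFields.YangMills.Cruxes.TunedSequenceExists.Disproof

/-! ## § Scheme — what the shape clause forces (no group needed) -/

section Scheme

variable {ι : Type}

/-- Shape clause + `a_k → 0` force `M^{n_k} → ∞`. -/
theorem tendsto_pow_of_shape {M : ℕ} (sch : SpeciesScheme ι) {n : ℕ → ℕ}
    (hshape : ∀ k, sch.a k = ((M : ℝ) ^ n k)⁻¹) :
    Tendsto (fun k => (M : ℝ) ^ n k) atTop atTop := by
  have hinv : ∀ k, (M : ℝ) ^ n k = (sch.a k)⁻¹ := fun k => by rw [hshape k, inv_inv]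
  simp only [hinv]
  exact (tendsto_inv_nhdsGT_zero.comp
    (tendsto_nhdsWithin_iff.2 ⟨sch.tendsto_a, Eventually.of_forall fun k => sch.a_pos k⟩))

/-- Shape clause + `a_k → 0` force `n_k → ∞` (for `M ≥ 2`). -/
theorem tendsto_exponent_of_shape {M : ℕ} (hM : 2 ≤ M) (sch : SpeciesScheme ι)
    {n : ℕ → ℕ} (hshape : ∀ k, sch.a k = ((M : ℝ) ^ n k)⁻¹) :
    Tendsto n atTop atTop := by
  have hpow := tendsto_pow_of_shape sch hshape
  refine tendsto_atTop.2 fun m => ?_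
  have hM1 : (1 : ℝ) < M := by exact_mod_cast hM
  filter_upwards [tendsto_atTop.1 hpow ((M : ℝ) ^ m)] with k hk
  exact (pow_le_pow_iff_right₀ hM1).1 hk

/-- No wrap-around: the separations `t · M^{n_k}` eventually fit in the half-torus `L_k`
(from `a_k L_k → ∞`). -/
theorem eventually_sep_le_L {M : ℕ} (sch : SpeciesScheme ι) {n : ℕ → ℕ}
    (hshape : ∀ k, sch.a k = ((M : ℝ) ^ n k)⁻¹) (t : ℕ) :
    ∀ᶠ k in atTop, t * M ^ n k ≤ sch.L k := by
  filter_upwards [tendsto_atTop.1 sch.tendsto_L (t : ℝ)] with k hk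
  have ha : 0 < sch.a k := sch.a_pos k
  have hpow : (M : ℝ) ^ n k = (sch.a k)⁻¹ := by rw [hshape k, inv_inv]
  have h : (t : ℝ) * (M : ℝ) ^ n k ≤ sch.L k := by
    rw [hpow, ← div_eq_mul_inv, div_le_iff₀ ha, mul_comm]
    exact hk
  exact_mod_cast h

/-- If the shape clause holds with `M^{n_k} = 1` for all `k`, the scheme axioms are violated. -/
theorem false_of_a_eq_one (sch : SpeciesScheme ι) (h : ∀ k, sch.a k = 1) : False := by
  have h1 : Tendsto (fun _ : ℕ => (1 : ℝ)) atTop (𝓝 0) := by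
    have hfun : sch.a = fun _ => 1 := funext h
    exact hfun ▸ sch.tendsto_a
  have := tendsto_nhds_unique h1 tendsto_const_nhds
  norm_num at this

end Scheme

/-! ## § Shape — the crux body at fixed data -/

section Shape

variable {G : Type} [Group G] [TopologicalSpace G] [IsTopologicalGroup G] [CompactSpace G]
  [MeasurableSpace G] [BorelSpace G]

/-- The rescaled connected curvature two-point function `N_t(k)` of the crux, as a function of the
raw data `(β, S, D, t)`: `D^8 · ⟨P ; τ_{tD} P⟩_{β, S}` (`P = r.curvature.F`, torus of side `S`). -/
def rescaledCorr (r : LatticeRep G) (β : ℝ) (S : ℕ) [NeZero S] (D t : ℕ) : ℝ :=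
  (D : ℝ) ^ 8 * latticeConnectedCorr r.ρ β S r.curvature.F r.curvature.F (t * D)

/-- The body of the crux at fixed `(G, r, M)` (verbatim): a window `(0, θ₀)` of attainable tuned
limits. -/
def Window (r : LatticeRep G) (M : ℕ) : Prop :=
  ∃ θ₀ : ℝ, 0 < θ₀ ∧ ∀ θ : ℝ, 0 < θ → θ < θ₀ →
    ∃ (sch : SpeciesScheme (YMSpecies G)) (n : ℕ → ℕ),
      (∀ k, sch.a k = ((M : ℝ) ^ n k)⁻¹) ∧ Tendsto sch.β atTop atTop ∧
      (∀ t : ℕ, 0 < t → ∃ c : ℝ, Tendsto (fun k => ((M : ℝ) ^ n k) ^ 8 *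
          latticeConnectedCorr r.ρ (sch.β k) (sch.side k) r.curvature.F r.curvature.F
            (t * M ^ n k)) atTop (𝓝 c)) ∧
      Tendsto (fun k => ((M : ℝ) ^ n k) ^ 8 *
          latticeConnectedCorr r.ρ (sch.β k) (sch.side k) r.curvature.F r.curvature.F
            (M ^ n k)) atTop (𝓝 θ)

end Shape

/-- The crux is `∀ G simple, ∀ r, ∀ M ≥ 2, Window r M` (definitional unfolding). -/
theorem tunedSequenceExists_iff :
    TunedSequenceExists ↔
      ∀ (G : Type) [Group G] [TopologicalSpace G] [IsTopologicalGroup G] [CompactSpace G],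
        IsCompactSimpleLieGroup G → letI : MeasurableSpace G := borel G
        haveI : BorelSpace G := ⟨rfl⟩
        ∀ (r : LatticeRep G) (M : ℕ), 2 ≤ M → Window r M :=
  Iff.rfl

/-! ## § LoadBearing — `2 ≤ M` and non-degeneracy of `G` cannot be dropped -/

section LoadBearing

variable {G : Type} [Group G] [TopologicalSpace G] [IsTopologicalGroup G] [CompactSpace G]
  [MeasurableSpace G] [BorelSpace G]

/-- **`2 ≤ M` is load-bearing, part 1: `M = 1`.** For EVERY `G` and `r` the window at `M = 1` is
empty: the shape clause reads `a_k = 1`, contradicting `a_k → 0`. -/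
theorem not_window_one (r : LatticeRep G) : ¬ Window r 1 := by
  rintro ⟨θ₀, hθ₀, h⟩
  obtain ⟨sch, n, hshape, -, -, -⟩ := h (θ₀ / 2) (by positivity) (by linarith)
  exact false_of_a_eq_one sch fun k => by rw [hshape k]; simp

/-- **`2 ≤ M` is load-bearing, part 2: `M = 0`.** The shape clause reads `a_k = (0^{n_k})⁻¹ ∈ {0, 1}`
(Lean's `0⁻¹ = 0`): `a_k > 0` forces `n_k = 0`, hence `a_k = 1` for all `k`, contradicting `a_k → 0`. -/
theorem not_window_zero (r : LatticeRep G) : ¬ Window r 0 := by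
  rintro ⟨θ₀, hθ₀, h⟩
  obtain ⟨sch, n, hshape, -, -, -⟩ := h (θ₀ / 2) (by positivity) (by linarith)
  refine false_of_a_eq_one sch fun k => ?_
  have hk := hshape k
  rcases Nat.eq_zero_or_pos (n k) with h0 | hpos
  · simpa [h0] using hk
  · exfalso
    have : sch.a k = 0 := by simp [hk, zero_pow hpos.ne']
    exact (sch.a_pos k).ne' this

/-- `2 ≤ M` cannot be weakened to `True`: the variant of `Window` over all `M` fails at `M = 1`. -/
theorem not_forall_window (r : LatticeRep G) : ¬ ∀ M : ℕ, Window r M :=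
  fun h => not_window_one r (h 1)

/-- For the trivial group every connected correlator of every pair of observables vanishes
(all configurations coincide; the Wilson measure is a probability measure). -/
theorem latticeConnectedCorr_eq_zero_of_subsingleton [Subsingleton G] {N : ℕ}
    (ρ : G →* Matrix (Fin N) (Fin N) ℂ) (hρ : Continuous ρ) (β : ℝ) (S : ℕ) [NeZero S]
    (A B : LGConfig 4 G → ℝ) (m : ℕ) :
    latticeConnectedCorr ρ β S A B m = 0 := by
  haveI := isProbabilityMeasure_wilsonMeasure (d := 4) (L := S) ρ hρ β
  have hU : ∀ U V : LGConfig 4 G, U = V := fun U V => Subsingleton.elim U V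
  set U₀ : LGConfig 4 G := fun _ => 1
  have hA : ∀ V, A V = A U₀ := fun V => by rw [hU V U₀]
  have hB : ∀ V, B V = B U₀ := fun V => by rw [hU V U₀]
  unfold latticeConnectedCorr
  simp only [hA, hB, integral_const, smul_eq_mul, probReal_univ]
  ring

/-- **Non-degeneracy of `G` is load-bearing.** For the trivial group (any faithful `r`, e.g. the
`1 × 1` trivial representation) the window is empty for every `M`: `N_1(k) ≡ 0` cannot tend to
`θ > 0`. `IsCompactSimpleLieGroup` excludes this through its non-abelian clause. -/
theorem not_window_of_subsingleton [Subsingleton G] (r : LatticeRep G) (M : ℕ) : ¬ Window r M := by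
  rintro ⟨θ₀, hθ₀, h⟩
  obtain ⟨sch, n, -, -, -, hlim⟩ := h (θ₀ / 2) (by positivity) (by linarith)
  have h0 : Tendsto (fun k => ((M : ℝ) ^ n k) ^ 8 *
      latticeConnectedCorr r.ρ (sch.β k) (sch.side k) r.curvature.F r.curvature.F (M ^ n k))
      atTop (𝓝 0) := by
    simp only [latticeConnectedCorr_eq_zero_of_subsingleton r.ρ r.continuous, mul_zero]
    exact tendsto_const_nhds
  have := tendsto_nhds_unique hlim h0
  linarith

end LoadBearing

/-- The trivial group carries a lattice representation (the trivial character, `N = 1`). -/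
def LatticeRep.unit : LatticeRep Unit where
  N := 1
  ρ := 1
  continuous := continuous_const
  injective := fun _ _ _ => Subsingleton.elim _ _
  mem_unitary := fun _ => by simp

/-- The crux with the simplicity hypothesis `IsCompactSimpleLieGroup G` dropped (all compact
groups admitted). -/
def TunedSequenceExistsWithoutSimple : Prop :=
  ∀ (G : Type) [Group G] [TopologicalSpace G] [IsTopologicalGroup G] [CompactSpace G],
    letI : MeasurableSpace G := borel G
    haveI : BorelSpace G := ⟨rfl⟩
    ∀ (r : LatticeRep G) (M : ℕ), 2 ≤ M → Window r M

/-- **Any proof of (S) must use that `G` is non-degenerate**: without `IsCompactSimpleLieGroup`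
the statement is false (witness: the trivial group, `M = 2`). -/
theorem not_tunedSequenceExistsWithoutSimple : ¬ TunedSequenceExistsWithoutSimple := by
  intro h
  letI : MeasurableSpace Unit := borel Unit
  haveI : BorelSpace Unit := ⟨rfl⟩
  exact not_window_of_subsingleton LatticeRep.unit 2 (h Unit LatticeRep.unit 2 le_rfl)

/-! ## § ClauseThree — clause (iii) costs exactly an a-priori bound on the `N_t`

Clause (iii) asks that EVERY rescaled correlator `N_t(k)`, `t ≥ 1`, converge along the witness.
Since the witness is existential and its index set is free, a diagonal subsequence of any
witness-with-bounded-`N_t` is again a witness (schemes are stable under re-indexing along a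
strictly increasing map). Hence `Window r M ↔ WindowBdd r M`: modulo the tuning clause (iv), the
whole content of (iii) is an a-priori bound `sup_k |N_t(k)| < ∞` for each `t ≥ 2` (for `t = 1` it
follows from (iv)). Physically `0 ≤ N_t ≤ N_1` (positivity of the transfer operator); formally this
is NOT in the tree: `wilsonExpectation_reflectionPositive` / `WilsonSiteRPForm` are stated for EVEN
torus sides, the scheme's side `2 L_k + 1` is odd, and `P` contains temporal plaquettes (not a
time-zero multiplication operator), so "`N_t ≤ N_1` by RP" is a genuine gap a prover must fill
(or avoid, e.g. by a volume-comparison / a-priori `O(a^8)`-type bound). -/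

section ClauseThree

variable {ι : Type}

/-- Re-indexing a scaling scheme along a strictly increasing map `φ : ℕ → ℕ` gives a scaling
scheme (`a ∘ φ → 0` and `(a L) ∘ φ → ∞` along the subsequence). -/
def reindex (sch : SpeciesScheme ι) (φ : ℕ → ℕ) (hφ : StrictMono φ) : SpeciesScheme ι where
  a := sch.a ∘ φ
  a_pos k := sch.a_pos (φ k)
  tendsto_a := sch.tendsto_a.comp hφ.tendsto_atTop
  β := sch.β ∘ φ
  L := sch.L ∘ φ
  tendsto_L := sch.tendsto_L.comp hφ.tendsto_atTop
  c s := sch.c s ∘ φ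
  m s := sch.m s ∘ φ

@[simp] theorem reindex_a (sch : SpeciesScheme ι) (φ : ℕ → ℕ) (hφ : StrictMono φ) (k : ℕ) :
    (reindex sch φ hφ).a k = sch.a (φ k) := rfl

@[simp] theorem reindex_β (sch : SpeciesScheme ι) (φ : ℕ → ℕ) (hφ : StrictMono φ) (k : ℕ) :
    (reindex sch φ hφ).β k = sch.β (φ k) := rfl

@[simp] theorem reindex_L (sch : SpeciesScheme ι) (φ : ℕ → ℕ) (hφ : StrictMono φ) (k : ℕ) :
    (reindex sch φ hφ).L k = sch.L (φ k) := rfl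

@[simp] theorem reindex_side (sch : SpeciesScheme ι) (φ : ℕ → ℕ) (hφ : StrictMono φ) (k : ℕ) :
    (reindex sch φ hφ).side k = sch.side (φ k) := rfl

variable {G : Type} [Group G] [TopologicalSpace G] [IsTopologicalGroup G] [CompactSpace G]
  [MeasurableSpace G] [BorelSpace G]

/-- The crux body with clause (iii) WEAKENED to boundedness of every `N_t` along the witness. -/
def WindowBdd (r : LatticeRep G) (M : ℕ) : Prop :=
  ∃ θ₀ : ℝ, 0 < θ₀ ∧ ∀ θ : ℝ, 0 < θ → θ < θ₀ →
    ∃ (sch : SpeciesScheme (YMSpecies G)) (n : ℕ → ℕ),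
      (∀ k, sch.a k = ((M : ℝ) ^ n k)⁻¹) ∧ Tendsto sch.β atTop atTop ∧
      (∀ t : ℕ, 0 < t → ∃ C : ℝ, ∀ k, |((M : ℝ) ^ n k) ^ 8 *
          latticeConnectedCorr r.ρ (sch.β k) (sch.side k) r.curvature.F r.curvature.F
            (t * M ^ n k)| ≤ C) ∧
      Tendsto (fun k => ((M : ℝ) ^ n k) ^ 8 *
          latticeConnectedCorr r.ρ (sch.β k) (sch.side k) r.curvature.F r.curvature.F
            (M ^ n k)) atTop (𝓝 θ)

/-- The crux body with clause (iii) DROPPED (shape, `β_k → ∞`, tuning only). -/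
def WindowWeak (r : LatticeRep G) (M : ℕ) : Prop :=
  ∃ θ₀ : ℝ, 0 < θ₀ ∧ ∀ θ : ℝ, 0 < θ → θ < θ₀ →
    ∃ (sch : SpeciesScheme (YMSpecies G)) (n : ℕ → ℕ),
      (∀ k, sch.a k = ((M : ℝ) ^ n k)⁻¹) ∧ Tendsto sch.β atTop atTop ∧
      Tendsto (fun k => ((M : ℝ) ^ n k) ^ 8 *
          latticeConnectedCorr r.ρ (sch.β k) (sch.side k) r.curvature.F r.curvature.F
            (M ^ n k)) atTop (𝓝 θ)

/-- Convergent ⇒ bounded: the crux body implies its bounded variant. -/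
theorem windowBdd_of_window (r : LatticeRep G) (M : ℕ) (h : Window r M) : WindowBdd r M := by
  obtain ⟨θ₀, hθ₀, h⟩ := h
  refine ⟨θ₀, hθ₀, fun θ hθ hθ' => ?_⟩
  obtain ⟨sch, n, hshape, hβ, hconv, hlim⟩ := h θ hθ hθ'
  refine ⟨sch, n, hshape, hβ, fun t ht => ?_, hlim⟩
  obtain ⟨c, hc⟩ := hconv t ht
  obtain ⟨C, hC⟩ := isBounded_iff_forall_norm_le.1 (Metric.isBounded_range_of_tendsto _ hc)
  exact ⟨C, fun k => by simpa [Real.norm_eq_abs] using hC _ (Set.mem_range_self k)⟩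

/-- Either variant trivially implies the weak one. -/
theorem windowWeak_of_windowBdd (r : LatticeRep G) (M : ℕ) (h : WindowBdd r M) :
    WindowWeak r M := by
  obtain ⟨θ₀, hθ₀, h⟩ := h
  refine ⟨θ₀, hθ₀, fun θ hθ hθ' => ?_⟩
  obtain ⟨sch, n, hshape, hβ, -, hlim⟩ := h θ hθ hθ'
  exact ⟨sch, n, hshape, hβ, hlim⟩

/-- **Diagonal extraction.** A witness with bounded `N_t` (all `t ≥ 1`) has a re-indexing along
which every `N_t` converges; the re-indexed scheme is again an `M`-adic scheme with `β → ∞` and the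
same tuned limit. -/
theorem window_of_windowBdd (r : LatticeRep G) (M : ℕ) (h : WindowBdd r M) : Window r M := by
  obtain ⟨θ₀, hθ₀, h⟩ := h
  refine ⟨θ₀, hθ₀, fun θ hθ hθ' => ?_⟩
  obtain ⟨sch, n, hshape, hβ, hbdd, hlim⟩ := h θ hθ hθ'
  -- the family of rescaled correlators, indexed by `t' = t - 1`
  set u : ℕ → ℕ → ℝ := fun k t' => ((M : ℝ) ^ n k) ^ 8 *
    latticeConnectedCorr r.ρ (sch.β k) (sch.side k) r.curvature.F r.curvature.F
      ((t' + 1) * M ^ n k) with hu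
  choose C hC using fun t' : ℕ => hbdd (t' + 1) (Nat.succ_pos t')
  set K : Set (ℕ → ℝ) := Set.pi Set.univ fun t' => Set.Icc (-C t') (C t') with hK
  have hKc : IsCompact K := isCompact_univ_pi fun t' => isCompact_Icc
  have huK : ∀ k, u k ∈ K := fun k => by
    simp only [hK, Set.mem_pi, Set.mem_univ, true_implies, Set.mem_Icc]
    intro t'
    exact abs_le.1 (hC t' k)
  obtain ⟨lim, -, φ, hφ, hconv⟩ := hKc.tendsto_subseq huK
  refine ⟨reindex sch φ hφ, n ∘ φ, fun k => hshape (φ k), hβ.comp hφ.tendsto_atTop, ?_, ?_⟩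
  · intro t ht
    obtain ⟨t', rfl⟩ := Nat.exists_eq_succ_of_ne_zero ht.ne'
    refine ⟨lim t', ?_⟩
    have h1 : Tendsto (fun j => u (φ j) t') atTop (𝓝 (lim t')) := tendsto_pi_nhds.1 hconv t'
    refine h1.congr fun j => ?_
    simp only [hu, Function.comp_apply, reindex_β, reindex_side, Nat.succ_eq_add_one]
  · exact hlim.comp hφ.tendsto_atTop

/-- **Clause (iii) costs exactly an a-priori bound.** -/
theorem window_iff_windowBdd (r : LatticeRep G) (M : ℕ) : Window r M ↔ WindowBdd r M :=
  ⟨windowBdd_of_window r M, window_of_windowBdd r M⟩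

/-- The a-priori bound as a stand-alone input: along every `M`-adic scheme with `β_k → ∞` whose
`N_1` converges to a positive limit, each `N_t`, `t ≥ 2`, stays bounded. (Physically
`0 ≤ N_t ≤ N_1`; see the section docblock for why this is not formal yet.) -/
def AprioriBound (r : LatticeRep G) (M : ℕ) : Prop :=
  ∀ (sch : SpeciesScheme (YMSpecies G)) (n : ℕ → ℕ) (θ : ℝ), 0 < θ →
    (∀ k, sch.a k = ((M : ℝ) ^ n k)⁻¹) → Tendsto sch.β atTop atTop →
    Tendsto (fun k => ((M : ℝ) ^ n k) ^ 8 *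
        latticeConnectedCorr r.ρ (sch.β k) (sch.side k) r.curvature.F r.curvature.F
          (M ^ n k)) atTop (𝓝 θ) →
    ∀ t : ℕ, 2 ≤ t → ∃ C : ℝ, ∀ k, |((M : ℝ) ^ n k) ^ 8 *
        latticeConnectedCorr r.ρ (sch.β k) (sch.side k) r.curvature.F r.curvature.F
          (t * M ^ n k)| ≤ C

/-- **Reduction of the crux body to its weak form plus the a-priori bound**: with `AprioriBound`
the tuning clause alone suffices. Combined with gen-1's reduction (weak form ⟺ the finite-volume
correlator window lower bound, i.e. quantitative `ξ(β) → ∞`), the crux splits as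
(open lower bound) + (a-priori bound on `N_t`). -/
theorem window_of_windowWeak_of_aprioriBound (r : LatticeRep G) (M : ℕ) (hb : AprioriBound r M)
    (h : WindowWeak r M) : Window r M := by
  refine window_of_windowBdd r M ?_
  obtain ⟨θ₀, hθ₀, h⟩ := h
  refine ⟨θ₀, hθ₀, fun θ hθ hθ' => ?_⟩
  obtain ⟨sch, n, hshape, hβ, hlim⟩ := h θ hθ hθ'
  refine ⟨sch, n, hshape, hβ, fun t ht => ?_, hlim⟩
  rcases Nat.lt_or_ge t 2 with ht2 | ht2
  · obtain rfl : t = 1 := by omega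
    obtain ⟨C, hC⟩ := isBounded_iff_forall_norm_le.1 (Metric.isBounded_range_of_tendsto _ hlim)
    exact ⟨C, fun k => by simpa [Real.norm_eq_abs] using hC _ (Set.mem_range_self k)⟩
  · exact hb sch n θ hθ hshape hβ hlim t ht2

/-- **The transfer-operator (RP-type) input that would discharge clause (iii)**: positivity and
monotone decay of the finite-torus curvature correlator in the separation, within the half torus.
(Physically: spectral representation `⟨P ; τ_m P⟩ = ∫ λ^m dμ_P`, `μ_P ≥ 0` on `[0, 1]`; formally
open here — odd side, temporal plaquettes in `P`.) -/
def CorrMonotone (r : LatticeRep G) : Prop :=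
  ∀ (β : ℝ) (L m m' : ℕ), m ≤ m' → m' ≤ L →
    0 ≤ latticeConnectedCorr r.ρ β (2 * L + 1) r.curvature.F r.curvature.F m' ∧
    latticeConnectedCorr r.ρ β (2 * L + 1) r.curvature.F r.curvature.F m' ≤
      latticeConnectedCorr r.ρ β (2 * L + 1) r.curvature.F r.curvature.F m

omit [TopologicalSpace G] [IsTopologicalGroup G] [CompactSpace G] [BorelSpace G] in
/-- An eventually bounded real sequence is bounded. -/
theorem exists_bound_of_eventually {u : ℕ → ℝ} {C : ℝ} (h : ∀ᶠ k in atTop, |u k| ≤ C) :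
    ∃ C' : ℝ, ∀ k, |u k| ≤ C' := by
  obtain ⟨K, hK⟩ := eventually_atTop.1 h
  refine ⟨max C (∑ j ∈ Finset.range K, |u j|), fun k => ?_⟩
  rcases lt_or_ge k K with hk | hk
  · exact le_max_of_le_right
      (Finset.single_le_sum (fun j _ => abs_nonneg (u j)) (Finset.mem_range.2 hk))
  · exact le_max_of_le_left (hK k hk)

/-- **`CorrMonotone` discharges the a-priori bound**: `0 ≤ N_t(k) ≤ N_1(k)` eventually, and
`N_1` converges. So under transfer-operator positivity the crux body reduces to its weak form
(`window_of_windowWeak_of_aprioriBound`). -/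
theorem aprioriBound_of_corrMonotone (r : LatticeRep G) (M : ℕ) (h : CorrMonotone r) :
    AprioriBound r M := by
  intro sch n θ hθ hshape hβ hlim t ht
  obtain ⟨C₁, hC₁⟩ := isBounded_iff_forall_norm_le.1 (Metric.isBounded_range_of_tendsto _ hlim)
  have hC₁' : ∀ k, |((M : ℝ) ^ n k) ^ 8 *
      latticeConnectedCorr r.ρ (sch.β k) (sch.side k) r.curvature.F r.curvature.F (M ^ n k)| ≤
        C₁ := fun k => by simpa [Real.norm_eq_abs] using hC₁ _ (Set.mem_range_self k)
  refine exists_bound_of_eventually (C := C₁) ?_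
  filter_upwards [eventually_sep_le_L sch hshape t] with k hk
  have ht1 : M ^ n k ≤ t * M ^ n k := Nat.le_mul_of_pos_left _ (by omega)
  obtain ⟨h0, hmono⟩ := h (sch.β k) (sch.L k) (M ^ n k) (t * M ^ n k) ht1 hk
  have hpow : (0 : ℝ) ≤ ((M : ℝ) ^ n k) ^ 8 := by positivity
  have h0' : 0 ≤ ((M : ℝ) ^ n k) ^ 8 *
      latticeConnectedCorr r.ρ (sch.β k) (sch.side k) r.curvature.F r.curvature.F (t * M ^ n k) :=
    mul_nonneg hpow h0
  have hle : ((M : ℝ) ^ n k) ^ 8 *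
      latticeConnectedCorr r.ρ (sch.β k) (sch.side k) r.curvature.F r.curvature.F (t * M ^ n k) ≤
      ((M : ℝ) ^ n k) ^ 8 *
        latticeConnectedCorr r.ρ (sch.β k) (sch.side k) r.curvature.F r.curvature.F (M ^ n k) :=
    mul_le_mul_of_nonneg_left hmono hpow
  rw [abs_of_nonneg h0']
  exact hle.trans ((le_abs_self _).trans (hC₁' k))

/-- Hence, under `CorrMonotone`, the crux body IS its weak form. -/
theorem window_iff_windowWeak_of_corrMonotone (r : LatticeRep G) (M : ℕ) (h : CorrMonotone r) :
    Window r M ↔ WindowWeak r M :=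
  ⟨fun hw => windowWeak_of_windowBdd r M (windowBdd_of_window r M hw),
    window_of_windowWeak_of_aprioriBound r M (aprioriBound_of_corrMonotone r M h)⟩

/-- `CorrMonotone` restricted to non-negative couplings — the only range where link-reflection
positivity of Wilson's action (character coefficients `≥ 0`) is available, and all the crux needs
since `β_k → ∞`. PROVERS: do not try to establish `CorrMonotone` for `β < 0` (frustrated regime on
the odd torus; transfer-operator positivity is not expected there); this weaker input suffices. -/
def CorrMonotoneNonneg (r : LatticeRep G) : Prop :=
  ∀ (β : ℝ) (L m m' : ℕ), 0 ≤ β → m ≤ m' → m' ≤ L →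
    0 ≤ latticeConnectedCorr r.ρ β (2 * L + 1) r.curvature.F r.curvature.F m' ∧
    latticeConnectedCorr r.ρ β (2 * L + 1) r.curvature.F r.curvature.F m' ≤
      latticeConnectedCorr r.ρ β (2 * L + 1) r.curvature.F r.curvature.F m

theorem corrMonotoneNonneg_of_corrMonotone (r : LatticeRep G) (h : CorrMonotone r) :
    CorrMonotoneNonneg r :=
  fun β L m m' _ hm hm' => h β L m m' hm hm'

/-- **`CorrMonotoneNonneg` already discharges the a-priori bound** (`β_k ≥ 0` eventually along any
scheme with `β_k → ∞`). -/
theorem aprioriBound_of_corrMonotoneNonneg (r : LatticeRep G) (M : ℕ) (h : CorrMonotoneNonneg r) :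
    AprioriBound r M := by
  intro sch n θ hθ hshape hβ hlim t ht
  obtain ⟨C₁, hC₁⟩ := isBounded_iff_forall_norm_le.1 (Metric.isBounded_range_of_tendsto _ hlim)
  have hC₁' : ∀ k, |((M : ℝ) ^ n k) ^ 8 *
      latticeConnectedCorr r.ρ (sch.β k) (sch.side k) r.curvature.F r.curvature.F (M ^ n k)| ≤
        C₁ := fun k => by simpa [Real.norm_eq_abs] using hC₁ _ (Set.mem_range_self k)
  refine exists_bound_of_eventually (C := C₁) ?_
  filter_upwards [eventually_sep_le_L sch hshape t, tendsto_atTop.1 hβ 0] with k hk hβ0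
  have ht1 : M ^ n k ≤ t * M ^ n k := Nat.le_mul_of_pos_left _ (by omega)
  obtain ⟨h0, hmono⟩ := h (sch.β k) (sch.L k) (M ^ n k) (t * M ^ n k) hβ0 ht1 hk
  have hpow : (0 : ℝ) ≤ ((M : ℝ) ^ n k) ^ 8 := by positivity
  have h0' : 0 ≤ ((M : ℝ) ^ n k) ^ 8 *
      latticeConnectedCorr r.ρ (sch.β k) (sch.side k) r.curvature.F r.curvature.F (t * M ^ n k) :=
    mul_nonneg hpow h0
  have hle : ((M : ℝ) ^ n k) ^ 8 *
      latticeConnectedCorr r.ρ (sch.β k) (sch.side k) r.curvature.F r.curvature.F (t * M ^ n k) ≤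
      ((M : ℝ) ^ n k) ^ 8 *
        latticeConnectedCorr r.ρ (sch.β k) (sch.side k) r.curvature.F r.curvature.F (M ^ n k) :=
    mul_le_mul_of_nonneg_left hmono hpow
  rw [abs_of_nonneg h0']
  exact hle.trans ((le_abs_self _).trans (hC₁' k))

/-- Hence the crux body is its weak form already under `CorrMonotoneNonneg`. -/
theorem window_iff_windowWeak_of_corrMonotoneNonneg (r : LatticeRep G) (M : ℕ)
    (h : CorrMonotoneNonneg r) : Window r M ↔ WindowWeak r M :=
  ⟨fun hw => windowWeak_of_windowBdd r M (windowBdd_of_window r M hw),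
    window_of_windowWeak_of_aprioriBound r M (aprioriBound_of_corrMonotoneNonneg r M h)⟩

end ClauseThree

/-! ## § Freezing — fixed torus, `β → ∞`: Laplace concentration on flat configurations -/

/-! ### Abstract Laplace concentration -/

section Laplace

variable {X : Type*} [TopologicalSpace X] [CompactSpace X] [MeasurableSpace X]
  [OpensMeasurableSpace X]

/-- A continuous real function on a compact space is integrable for a finite measure. -/
theorem integrable_of_continuous (μ : Measure X) [IsFiniteMeasure μ] {f : X → ℝ}
    (hf : Continuous f) : Integrable f μ := by
  obtain ⟨C, hC⟩ := isCompact_univ.exists_bound_of_continuousOn hf.continuousOn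
  exact Integrable.of_bound hf.aestronglyMeasurable C (ae_of_all _ fun x => hC x (Set.mem_univ x))

omit [MeasurableSpace X] [OpensMeasurableSpace X] in
/-- Uniform approximation near the zero set: if `g = c` on `{S = 0}` then for every `ε > 0` there
is `δ > 0` with `|g x - c| < ε` whenever `S x < δ` (compactness). -/
theorem exists_delta_of_eq_on_zeroSet {S g : X → ℝ} (hS : Continuous S) (hg : Continuous g)
    {c : ℝ} (hgc : ∀ x, S x = 0 → g x = c) (hS0 : ∀ x, 0 ≤ S x) {ε : ℝ} (hε : 0 < ε) :
    ∃ δ : ℝ, 0 < δ ∧ ∀ x, S x < δ → |g x - c| < ε := by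
  set A : Set X := {x | ε ≤ |g x - c|} with hA
  have hAc : IsCompact A :=
    (isClosed_le continuous_const (continuous_abs.comp (hg.sub continuous_const))).isCompact
  by_cases hne : A.Nonempty
  · obtain ⟨x₁, hx₁, hmin⟩ := hAc.exists_isMinOn hne hS.continuousOn
    have hpos : 0 < S x₁ := by
      rcases (hS0 x₁).lt_or_eq with h | h
      · exact h
      · exfalso
        have : g x₁ = c := hgc x₁ h.symm
        have hx₁' : ε ≤ |g x₁ - c| := hx₁
        rw [this, sub_self, abs_zero] at hx₁'
        exact absurd hx₁' (not_le.2 hε)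
    refine ⟨S x₁, hpos, fun x hx => ?_⟩
    by_contra hcon
    have hxA : x ∈ A := not_lt.1 hcon
    exact absurd (hmin hxA) (not_le.2 hx)
  · refine ⟨1, one_pos, fun x _ => ?_⟩
    by_contra hcon
    exact hne ⟨x, not_lt.1 hcon⟩

/-- **Abstract Laplace concentration of Gibbs averages.** On a compact space with a finite,
open-positive reference measure, for a continuous `S ≥ 0` with a zero and a continuous `g` that is
constant `= c` on the zero set of `S`, the Gibbs averages `∫ g e^{-βS} / ∫ e^{-βS}` tend to `c` as
`β → ∞`. -/
theorem tendsto_laplaceAverage (μ : Measure X) [IsFiniteMeasure μ] [μ.IsOpenPosMeasure]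
    {S g : X → ℝ} (hS : Continuous S) (hg : Continuous g) (hS0 : ∀ x, 0 ≤ S x)
    {x₀ : X} (hx₀ : S x₀ = 0) {c : ℝ} (hgc : ∀ x, S x = 0 → g x = c) :
    Tendsto (fun β : ℝ => (∫ x, g x * Real.exp (-β * S x) ∂μ) / (∫ x, Real.exp (-β * S x) ∂μ))
      atTop (𝓝 c) := by
  -- notation
  set w : ℝ → X → ℝ := fun β x => Real.exp (-β * S x) with hw
  have hwc : ∀ β, Continuous (w β) := fun β =>
    Real.continuous_exp.comp (continuous_const.mul hS)
  have hw_pos : ∀ β x, 0 < w β x := fun β x => Real.exp_pos _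
  have hw_anti : ∀ β x δ, 0 ≤ β → δ ≤ S x → w β x ≤ Real.exp (-β * δ) := fun β x δ hβ hδ => by
    simp only [hw]
    exact Real.exp_le_exp.2 (by nlinarith)
  -- mass near the zero set
  have hmass : ∀ δ : ℝ, 0 < δ → 0 < μ.real {x | S x < δ} := fun δ hδ => by
    have hopen : IsOpen {x | S x < δ} := isOpen_lt hS continuous_const
    have hne : ({x | S x < δ} : Set X).Nonempty := ⟨x₀, by simp [hx₀, hδ]⟩
    exact ENNReal.toReal_pos (hopen.measure_pos μ hne).ne' (measure_ne_top μ _)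
  -- lower bound for the partition function
  have hZ_ge : ∀ β δ : ℝ, 0 ≤ β → 0 < δ →
      Real.exp (-β * δ) * μ.real {x | S x < δ} ≤ ∫ x, w β x ∂μ := fun β δ hβ hδ => by
    have hms : MeasurableSet {x | S x < δ} := (isOpen_lt hS continuous_const).measurableSet
    calc Real.exp (-β * δ) * μ.real {x | S x < δ}
        = ∫ x, Set.indicator {x | S x < δ} (fun _ => Real.exp (-β * δ)) x ∂μ := by
          rw [integral_indicator_const _ hms, smul_eq_mul, mul_comm]
      _ ≤ ∫ x, w β x ∂μ := by
          refine integral_mono ?_ (integrable_of_continuous μ (hwc β)) fun x => ?_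
          · exact (integrable_const _).indicator hms
          · by_cases hx : S x < δ
            · simp only [Set.indicator_of_mem (show x ∈ {x | S x < δ} from hx), hw]
              exact Real.exp_le_exp.2 (by nlinarith [hS0 x])
            · simp only [Set.indicator_of_notMem (show x ∉ {x | S x < δ} from hx)]
              exact (hw_pos β x).le
  have hZ_pos : ∀ β : ℝ, 0 ≤ β → 0 < ∫ x, w β x ∂μ := fun β hβ =>
    lt_of_lt_of_le (mul_pos (Real.exp_pos _) (hmass 1 one_pos)) (hZ_ge β 1 hβ one_pos)
  -- sup bound on |g - c|
  obtain ⟨B₀, hB₀⟩ := isCompact_univ.exists_bound_of_continuousOn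
    (hg.sub continuous_const : Continuous fun x => g x - c).continuousOn
  set B : ℝ := max B₀ 0 with hB
  have hBnn : 0 ≤ B := le_max_right _ _
  have hgB : ∀ x, |g x - c| ≤ B := fun x =>
    (Real.norm_eq_abs _ ▸ hB₀ x (Set.mem_univ x)).trans (le_max_left _ _)
  -- the ε/2 argument
  refine Metric.tendsto_atTop.2 fun ε hε => ?_
  obtain ⟨δ, hδ, hδε⟩ := exists_delta_of_eq_on_zeroSet hS hg hgc hS0 (half_pos hε)
  set m : ℝ := μ.real {x | S x < δ / 2} with hm
  have hm_pos : 0 < m := hmass _ (half_pos hδ)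
  set U : ℝ := μ.real Set.univ with hU
  -- the tail term tends to zero
  have htail : Tendsto (fun β : ℝ => B * U / m * Real.exp (-β * (δ / 2))) atTop (𝓝 0) := by
    have h1 : Tendsto (fun β : ℝ => -β * (δ / 2)) atTop atBot := by
      have h0 : Tendsto (fun β : ℝ => β * (δ / 2)) atTop atTop :=
        tendsto_id.atTop_mul_const (half_pos hδ)
      refine (tendsto_neg_atTop_atBot.comp h0).congr fun β => ?_
      simp only [Function.comp_apply, neg_mul]
    have h2 := Real.tendsto_exp_atBot.comp h1
    simpa using h2.const_mul (B * U / m)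
  obtain ⟨β₁, hβ₁⟩ := eventually_atTop.1 (htail.eventually (gt_mem_nhds (half_pos hε)))
  refine ⟨max β₁ 0, fun β hβ => ?_⟩
  have hβ0 : 0 ≤ β := le_trans (le_max_right _ _) hβ
  have hβ1 : β₁ ≤ β := le_trans (le_max_left _ _) hβ
  have hZ := hZ_pos β hβ0
  -- pointwise estimate
  have hpt : ∀ x, |(g x - c) * w β x| ≤ ε / 2 * w β x + B * Real.exp (-β * δ) := fun x => by
    rw [abs_mul, abs_of_pos (hw_pos β x)]
    by_cases hx : S x < δ
    · have h1 : |g x - c| * w β x ≤ ε / 2 * w β x :=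
        mul_le_mul_of_nonneg_right (hδε x hx).le (hw_pos β x).le
      have h2 : 0 ≤ B * Real.exp (-β * δ) := mul_nonneg hBnn (Real.exp_pos _).le
      linarith
    · have h1 : |g x - c| * w β x ≤ B * Real.exp (-β * δ) :=
        mul_le_mul (hgB x) (hw_anti β x δ hβ0 (not_lt.1 hx)) (hw_pos β x).le hBnn
      have h2 : 0 ≤ ε / 2 * w β x := mul_nonneg (half_pos hε).le (hw_pos β x).le
      linarith
  -- integrate
  have hint_gw : Integrable (fun x => g x * w β x) μ := integrable_of_continuous μ (hg.mul (hwc β))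
  have hint_w : Integrable (w β) μ := integrable_of_continuous μ (hwc β)
  have hnum : (∫ x, g x * w β x ∂μ) - c * ∫ x, w β x ∂μ = ∫ x, (g x - c) * w β x ∂μ := by
    rw [← integral_const_mul, ← integral_sub hint_gw (hint_w.const_mul c)]
    refine integral_congr_ae (ae_of_all _ fun x => ?_)
    ring
  have hbound : |(∫ x, g x * w β x ∂μ) - c * ∫ x, w β x ∂μ| ≤
      ε / 2 * (∫ x, w β x ∂μ) + B * Real.exp (-β * δ) * U := by
    rw [hnum]
    calc |∫ x, (g x - c) * w β x ∂μ| ≤ ∫ x, |(g x - c) * w β x| ∂μ := abs_integral_le_integral_abs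
      _ ≤ ∫ x, (ε / 2 * w β x + B * Real.exp (-β * δ)) ∂μ := by
          refine integral_mono ?_ ((hint_w.const_mul _).add (integrable_const _)) hpt
          exact (integrable_of_continuous μ ((hg.sub continuous_const).mul (hwc β))).abs
      _ = ε / 2 * (∫ x, w β x ∂μ) + B * Real.exp (-β * δ) * U := by
          rw [integral_add (hint_w.const_mul _) (integrable_const _), integral_const_mul,
            integral_const, smul_eq_mul, hU]
          ring
  -- divide by Z
  have hdiv : |(∫ x, g x * w β x ∂μ) / (∫ x, w β x ∂μ) - c| ≤
      ε / 2 + B * Real.exp (-β * δ) * U / ∫ x, w β x ∂μ := by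
    have hZne : (∫ x, w β x ∂μ) ≠ 0 := hZ.ne'
    have : (∫ x, g x * w β x ∂μ) / (∫ x, w β x ∂μ) - c =
        ((∫ x, g x * w β x ∂μ) - c * ∫ x, w β x ∂μ) / ∫ x, w β x ∂μ := by
      field_simp
    rw [this, abs_div, abs_of_pos hZ, div_le_iff₀ hZ]
    calc |(∫ x, g x * w β x ∂μ) - c * ∫ x, w β x ∂μ|
        ≤ ε / 2 * (∫ x, w β x ∂μ) + B * Real.exp (-β * δ) * U := hbound
      _ = (ε / 2 + B * Real.exp (-β * δ) * U / ∫ x, w β x ∂μ) * ∫ x, w β x ∂μ := by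
          field_simp
  -- the tail in terms of exp(-β δ/2)
  have htail_le : B * Real.exp (-β * δ) * U / (∫ x, w β x ∂μ) ≤
      B * U / m * Real.exp (-β * (δ / 2)) := by
    have hnum_nn : 0 ≤ B * Real.exp (-β * δ) * U :=
      mul_nonneg (mul_nonneg hBnn (Real.exp_pos _).le) measureReal_nonneg
    have hden : Real.exp (-β * (δ / 2)) * m ≤ ∫ x, w β x ∂μ := hZ_ge β (δ / 2) hβ0 (half_pos hδ)
    have hden_pos : 0 < Real.exp (-β * (δ / 2)) * m := mul_pos (Real.exp_pos _) hm_pos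
    calc B * Real.exp (-β * δ) * U / (∫ x, w β x ∂μ)
        ≤ B * Real.exp (-β * δ) * U / (Real.exp (-β * (δ / 2)) * m) :=
          div_le_div_of_nonneg_left hnum_nn hden_pos hden
      _ = B * U / m * Real.exp (-β * (δ / 2)) := by
          have hsplit : Real.exp (-β * δ) = Real.exp (-β * (δ / 2)) * Real.exp (-β * (δ / 2)) := by
            rw [← Real.exp_add]; ring_nf
          rw [hsplit]
          field_simp
  have htail_lt : B * U / m * Real.exp (-β * (δ / 2)) < ε / 2 := hβ₁ β hβ1
  rw [Real.dist_eq]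
  linarith

end Laplace

/-! ### Freezing of the Wilson theory on a fixed torus as `β → ∞` -/

section Wilson

variable {G : Type} [Group G] [TopologicalSpace G] [IsTopologicalGroup G] [CompactSpace G]
  [MeasurableSpace G] [BorelSpace G] {N : ℕ}

omit [IsTopologicalGroup G] [CompactSpace G] [MeasurableSpace G] [BorelSpace G] in
/-- A faithful continuous matrix representation makes the compact group second countable. -/
theorem secondCountable_of_latticeRep [CompactSpace G] (r : LatticeRep G) :
    SecondCountableTopology G :=
  (r.continuous.isClosedEmbedding r.injective).isEmbedding.secondCountableTopology

omit [TopologicalSpace G] [IsTopologicalGroup G] [CompactSpace G] [MeasurableSpace G]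
  [BorelSpace G] in
/-- `Re tr M ≤ N` for a unitary `N × N` matrix. -/
theorem re_trace_le_of_mem_unitaryGroup {M : Matrix (Fin N) (Fin N) ℂ}
    (hM : M ∈ Matrix.unitaryGroup (Fin N) ℂ) : M.trace.re ≤ N := by
  have h : |M.trace.re| ≤ N := by
    calc |M.trace.re| ≤ ‖M.trace‖ := Complex.abs_re_le_norm _
      _ = ‖∑ i, M i i‖ := rfl
      _ ≤ ∑ i, ‖M i i‖ := norm_sum_le _ _
      _ ≤ ∑ _i : Fin N, (1 : ℝ) := Finset.sum_le_sum fun i _ => entry_norm_bound_of_unitary hM i i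
      _ = N := by simp
  exact (abs_le.1 h).2

omit [IsTopologicalGroup G] [CompactSpace G] [MeasurableSpace G] [BorelSpace G] in
/-- Plaquette holonomies depend continuously on the configuration. -/
theorem continuous_plaquetteHolonomy [IsTopologicalGroup G] {S : ℕ} (x : Site 4 S) (i j : Fin 4) :
    Continuous fun U : GaugeConfig 4 S G => plaquetteHolonomy U x i j := by
  unfold plaquetteHolonomy
  fun_prop

omit [CompactSpace G] [MeasurableSpace G] [BorelSpace G] in
/-- The Wilson action of a finite torus is continuous (continuous `ρ`). -/
theorem continuous_wilsonAction {S : ℕ} [NeZero S] (ρ : G →* Matrix (Fin N) (Fin N) ℂ)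
    (hρ : Continuous ρ) : Continuous (wilsonAction (d := 4) (L := S) ρ) := by
  unfold wilsonAction
  refine continuous_finsetSum _ fun _ _ => ?_
  exact continuous_const.sub ((continuous_trace_re ρ hρ).comp (continuous_plaquetteHolonomy _ _ _))

omit [TopologicalSpace G] [IsTopologicalGroup G] [CompactSpace G] [MeasurableSpace G]
  [BorelSpace G] in
/-- The Wilson action is non-negative when `Re tr ρ ≤ N` (unitary `ρ`). -/
theorem wilsonAction_nonneg {S : ℕ} [NeZero S] (ρ : G →* Matrix (Fin N) (Fin N) ℂ)
    (hρN : ∀ g, (ρ g).trace.re ≤ N) (U : GaugeConfig 4 S G) : 0 ≤ wilsonAction ρ U :=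
  Finset.sum_nonneg fun _ _ => sub_nonneg.2 (hρN _)

omit [TopologicalSpace G] [IsTopologicalGroup G] [CompactSpace G] [MeasurableSpace G]
  [BorelSpace G] in
/-- The trivial configuration has zero Wilson action. -/
theorem wilsonAction_one {S : ℕ} [NeZero S] (ρ : G →* Matrix (Fin N) (Fin N) ℂ) :
    wilsonAction ρ (fun _ : Edge 4 S => (1 : G)) = 0 := by
  unfold wilsonAction plaquetteHolonomy
  simp [Matrix.trace_one]

omit [TopologicalSpace G] [IsTopologicalGroup G] [CompactSpace G] [MeasurableSpace G]
  [BorelSpace G] in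
/-- On the zero set of the Wilson action every plaquette trace is maximal. -/
theorem re_trace_eq_of_wilsonAction_eq_zero {S : ℕ} [NeZero S] (ρ : G →* Matrix (Fin N) (Fin N) ℂ)
    (hρN : ∀ g, (ρ g).trace.re ≤ N) {U : GaugeConfig 4 S G} (hU : wilsonAction ρ U = 0)
    (x : Site 4 S) (i j : Fin 4) (hij : i < j) :
    (ρ (plaquetteHolonomy U x i j)).trace.re = N := by
  have h := (Finset.sum_eq_zero_iff_of_nonneg (fun p _ => sub_nonneg.2 (hρN _))).1 hU
    (x, ⟨(i, j), hij⟩) (Finset.mem_univ _)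
  simp only at h
  linarith

/-- **Wilson expectations as Gibbs averages against product Haar measure.** -/
theorem integral_wilsonMeasure_eq_div [SecondCountableTopology G] {S : ℕ} [NeZero S]
    (ρ : G →* Matrix (Fin N) (Fin N) ℂ) (hρ : Continuous ρ) (β : ℝ) (F : GaugeConfig 4 S G → ℝ) :
    ∫ U, F U ∂(wilsonMeasure ρ β) =
      (∫ U, F U * Real.exp (-β * wilsonAction ρ U)
          ∂(Measure.pi fun _ : Edge 4 S => haarProbability G)) /
        ∫ U, Real.exp (-β * wilsonAction ρ U) ∂(Measure.pi fun _ : Edge 4 S => haarProbability G) := by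
  have hw : Measurable fun U : GaugeConfig 4 S G =>
      ENNReal.ofReal (Real.exp (-β * wilsonAction ρ U)) :=
    (Real.measurable_exp.comp ((measurable_wilsonAction ρ hρ).const_mul _)).ennreal_ofReal
  have hZ : partitionFunction (d := 4) (L := S) ρ β =
      ∫⁻ U, ENNReal.ofReal (Real.exp (-β * wilsonAction ρ U))
        ∂(Measure.pi fun _ : Edge 4 S => haarProbability G) := by
    simp only [partitionFunction, wilsonWeight, withDensity_apply _ MeasurableSet.univ,
      Measure.restrict_univ]
  have hZreal : (partitionFunction (d := 4) (L := S) ρ β).toReal =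
      ∫ U, Real.exp (-β * wilsonAction ρ U) ∂(Measure.pi fun _ : Edge 4 S => haarProbability G) := by
    rw [hZ, integral_eq_lintegral_of_nonneg_ae (ae_of_all _ fun U => (Real.exp_pos _).le)]
    exact (Real.measurable_exp.comp ((measurable_wilsonAction ρ hρ).const_mul _)).aestronglyMeasurable
  unfold wilsonMeasure
  rw [integral_smul_measure, wilsonWeight, integral_withDensity_eq_integral_toReal_smul hw
    (ae_of_all _ fun _ => ENNReal.ofReal_lt_top), ENNReal.toReal_inv, hZreal, smul_eq_mul,
    inv_mul_eq_div]
  congr 1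
  refine integral_congr_ae (ae_of_all _ fun U => ?_)
  beta_reduce
  rw [ENNReal.toReal_ofReal (Real.exp_pos _).le, smul_eq_mul, mul_comm]

/-- **Freezing of Wilson expectations**: for a continuous observable `F` on a FIXED torus which is
constant `= c` on the flat configurations (zero set of the Wilson action),
`⟨F⟩_β → c` as `β → ∞`. -/
theorem tendsto_integral_wilsonMeasure [SecondCountableTopology G] {S : ℕ} [NeZero S]
    (ρ : G →* Matrix (Fin N) (Fin N) ℂ) (hρ : Continuous ρ) (hρN : ∀ g, (ρ g).trace.re ≤ N)
    {F : GaugeConfig 4 S G → ℝ} (hF : Continuous F) {c : ℝ}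
    (hFc : ∀ U, wilsonAction ρ U = 0 → F U = c) :
    Tendsto (fun β : ℝ => ∫ U, F U ∂(wilsonMeasure ρ β)) atTop (𝓝 c) := by
  haveI : (haarProbability G).IsOpenPosMeasure := by unfold haarProbability; infer_instance
  haveI : IsFiniteMeasure (haarProbability G) := by unfold haarProbability; infer_instance
  simp only [integral_wilsonMeasure_eq_div ρ hρ]
  exact tendsto_laplaceAverage (Measure.pi fun _ : Edge 4 S => haarProbability G)
    (continuous_wilsonAction ρ hρ) hF (wilsonAction_nonneg ρ hρN) (wilsonAction_one ρ) hFc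

omit [TopologicalSpace G] [IsTopologicalGroup G] [CompactSpace G] [MeasurableSpace G]
  [BorelSpace G] in
/-- Plaquette holonomies of the periodic lift are the torus holonomies below. -/
theorem plaquetteHolonomyZd_torusLift' {S : ℕ} (U : GaugeConfig 4 S G)
    (y : Literature.Probability.LatticeModels.Site 4) (i j : Fin 4) :
    plaquetteHolonomyZd (torusLift S U) y i j =
      plaquetteHolonomy U (Literature.Probability.LatticeModels.Torus.proj S y) i j := by
  simp only [plaquetteHolonomyZd, plaquetteHolonomy, torusLift, torusEdge, Function.comp_apply,
    Site.shift, torusProj_add_single, Int.cast_one]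

omit [TopologicalSpace G] [IsTopologicalGroup G] [CompactSpace G] [BorelSpace G] in
/-- Plaquette holonomies of a translated configuration. -/
theorem plaquetteHolonomyZd_configShift (v : Literature.Probability.LatticeModels.Site 4)
    (W : LGConfig 4 G) (x : Literature.Probability.LatticeModels.Site 4) (i j : Fin 4) :
    plaquetteHolonomyZd (configShift v W) x i j = plaquetteHolonomyZd W (x - v) i j := by
  simp only [plaquetteHolonomyZd, configShift_apply, add_sub_right_comm]

omit [TopologicalSpace G] [IsTopologicalGroup G] [CompactSpace G] [BorelSpace G] in
/-- On flat configurations the (translated) action density of the lift is the constant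
`∑_{i<j} N`. -/
theorem actionDensity_configShift_torusLift_eq {S : ℕ} [NeZero S]
    (ρ : G →* Matrix (Fin N) (Fin N) ℂ) (hρN : ∀ g, (ρ g).trace.re ≤ N) {U : GaugeConfig 4 S G}
    (hU : wilsonAction ρ U = 0) (v : Literature.Probability.LatticeModels.Site 4) :
    actionDensity ρ (configShift v (torusLift S U)) =
      ∑ i : Fin 4, ∑ j : Fin 4, if i < j then (N : ℝ) else 0 := by
  unfold actionDensity
  refine Finset.sum_congr rfl fun i _ => Finset.sum_congr rfl fun j _ => ?_
  split_ifs with hij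
  · simp only [plaquetteObs, plaquetteHolonomyZd_configShift, plaquetteHolonomyZd_torusLift']
    exact re_trace_eq_of_wilsonAction_eq_zero ρ hρN hU _ i j hij
  · rfl

omit [TopologicalSpace G] [IsTopologicalGroup G] [CompactSpace G] [MeasurableSpace G]
  [BorelSpace G] in
/-- On flat configurations the action density of the lift is the constant `∑_{i<j} N`. -/
theorem actionDensity_torusLift_eq {S : ℕ} [NeZero S]
    (ρ : G →* Matrix (Fin N) (Fin N) ℂ) (hρN : ∀ g, (ρ g).trace.re ≤ N) {U : GaugeConfig 4 S G}
    (hU : wilsonAction ρ U = 0) :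
    actionDensity ρ (torusLift S U) = ∑ i : Fin 4, ∑ j : Fin 4, if i < j then (N : ℝ) else 0 := by
  unfold actionDensity
  refine Finset.sum_congr rfl fun i _ => Finset.sum_congr rfl fun j _ => ?_
  split_ifs with hij
  · simp only [plaquetteObs, plaquetteHolonomyZd_torusLift']
    exact re_trace_eq_of_wilsonAction_eq_zero ρ hρN hU _ i j hij
  · rfl

omit [Group G] [IsTopologicalGroup G] [CompactSpace G] [MeasurableSpace G] [BorelSpace G] in
/-- The periodic lift is continuous. -/
theorem continuous_torusLift (S : ℕ) : Continuous (torusLift (d := 4) (G := G) S) := by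
  unfold torusLift
  fun_prop

/-- **Freezing kills every connected curvature correlator on a fixed torus**: for every compact
`G`, every faithful unitary `r`, every torus side `S` and separation `m`,
`⟨P ; τ_m P⟩_{β, S} → 0` as `β → ∞` (the measure concentrates on flat configurations, where the
action density is constant). This is the upper endpoint `N_1(k, β) → 0` (`β → ∞`, `k` fixed) of the
planner's IVT, and the engine of the ceiling theorem below. -/
theorem latticeConnectedCorr_curvature_tendsto_zero (r : LatticeRep G) (S : ℕ) [NeZero S]
    (m : ℕ) :
    Tendsto (fun β : ℝ => latticeConnectedCorr r.ρ β S r.curvature.F r.curvature.F m)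
      atTop (𝓝 0) := by
  haveI : SecondCountableTopology G := secondCountable_of_latticeRep r
  have hρN : ∀ g, (r.ρ g).trace.re ≤ r.N := fun g => re_trace_le_of_mem_unitaryGroup (r.mem_unitary g)
  set c : ℝ := ∑ i : Fin 4, ∑ j : Fin 4, if i < j then (r.N : ℝ) else 0 with hc
  have hF : ∀ W, r.curvature.F W = actionDensity r.ρ W := fun W => rfl
  have hlift := continuous_torusLift (G := G) S
  have hA : Continuous fun U : GaugeConfig 4 S G => actionDensity r.ρ (torusLift S U) :=
    (continuous_actionDensity r.continuous).comp hlift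
  have hB : Continuous fun U : GaugeConfig 4 S G =>
      actionDensity r.ρ (configShift (-Pi.single 0 (m : ℤ)) (torusLift S U)) :=
    (continuous_actionDensity r.continuous).comp ((continuous_configShift _).comp hlift)
  have h1 := tendsto_integral_wilsonMeasure r.ρ r.continuous hρN
    (F := fun U : GaugeConfig 4 S G => actionDensity r.ρ (torusLift S U) *
      actionDensity r.ρ (configShift (-Pi.single 0 (m : ℤ)) (torusLift S U))) (hA.mul hB)
    (c := c * c) fun U hU => by
      simp only [actionDensity_torusLift_eq r.ρ hρN hU,
        actionDensity_configShift_torusLift_eq r.ρ hρN hU, hc]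
  have h2 := tendsto_integral_wilsonMeasure r.ρ r.continuous hρN hA (c := c)
    fun U hU => by simp only [actionDensity_torusLift_eq r.ρ hρN hU, hc]
  have h := h1.sub (h2.mul h2)
  rw [sub_self] at h
  simpa only [latticeConnectedCorr, hF] using h

end Wilson

/-! ## § Ceiling — the coupling of a tuned witness is capped by the lattice data

A natural strengthening of (S) asks for tuned witnesses whose couplings grow as fast as one likes
relative to the lattice data `(n_k, L_k)` ("`β_k → ∞` freely"). It is FALSE: by freezing, for each
`(m, L)` the rescaled correlator `(M^m)^8 ⟨P ; τ_{M^m} P⟩_{β, 2L+1}` is `< 1/(m+1)` once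
`β ≥ b(m, L)`, so every tuned witness eventually satisfies `β_k < b(n_k, L_k)`. Together with the
strong-coupling floor (gen 1: no witness at `β = 0` or at fixed small `β`), the divergence
`β_k → ∞` in (S) is a TUNED one: `β_k` must track the lattice data at the (unknown, conjecturally
asymptotically free `β ≍ log M^{n_k}`) rate. -/

section Ceiling

variable {G : Type} [Group G] [TopologicalSpace G] [IsTopologicalGroup G] [CompactSpace G]
  [MeasurableSpace G] [BorelSpace G]

/-- **Coupling ceiling.** For all `(m, L)` there is `b(m, L)` beyond which the rescaled correlator
at separation `M^m` on the torus of side `2L+1` is below `1/(m+1)`. -/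
theorem exists_ceiling (r : LatticeRep G) (M : ℕ) :
    ∃ b : ℕ → ℕ → ℝ, ∀ (m L : ℕ) (β : ℝ), b m L ≤ β →
      |((M : ℝ) ^ m) ^ 8 *
          latticeConnectedCorr r.ρ β (2 * L + 1) r.curvature.F r.curvature.F (M ^ m)| <
        1 / ((m : ℝ) + 1) := by
  have h : ∀ m L : ℕ, ∃ b : ℝ, ∀ β : ℝ, b ≤ β →
      |((M : ℝ) ^ m) ^ 8 *
          latticeConnectedCorr r.ρ β (2 * L + 1) r.curvature.F r.curvature.F (M ^ m)| <
        1 / ((m : ℝ) + 1) := fun m L => by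
    have ht := (latticeConnectedCorr_curvature_tendsto_zero r (2 * L + 1) (M ^ m)).const_mul
      (((M : ℝ) ^ m) ^ 8)
    rw [mul_zero] at ht
    have ht0 : Tendsto (fun β : ℝ => |((M : ℝ) ^ m) ^ 8 *
        latticeConnectedCorr r.ρ β (2 * L + 1) r.curvature.F r.curvature.F (M ^ m)|)
        atTop (𝓝 0) := by
      simpa using ht.abs
    have hε : (0 : ℝ) < 1 / ((m : ℝ) + 1) := by positivity
    exact eventually_atTop.1 (ht0.eventually (gt_mem_nhds hε))
  choose b hb using h
  exact ⟨b, hb⟩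

/-- **Every tuned witness stays below the ceiling eventually.** -/
theorem eventually_beta_lt_ceiling (r : LatticeRep G) {M : ℕ} (hM : 2 ≤ M) :
    ∃ b : ℕ → ℕ → ℝ, ∀ (sch : SpeciesScheme (YMSpecies G)) (n : ℕ → ℕ) (θ : ℝ), 0 < θ →
      (∀ k, sch.a k = ((M : ℝ) ^ n k)⁻¹) →
      Tendsto (fun k => ((M : ℝ) ^ n k) ^ 8 *
          latticeConnectedCorr r.ρ (sch.β k) (sch.side k) r.curvature.F r.curvature.F
            (M ^ n k)) atTop (𝓝 θ) →
      ∀ᶠ k in atTop, sch.β k < b (n k) (sch.L k) := by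
  obtain ⟨b, hb⟩ := exists_ceiling r M
  refine ⟨b, fun sch n θ hθ hshape hlim => ?_⟩
  have hn := tendsto_exponent_of_shape hM sch hshape
  -- eventually the tuned correlator exceeds θ/2 …
  have hθ2 : θ / 2 < θ := by linarith
  have hev1 : ∀ᶠ k in atTop, θ / 2 < ((M : ℝ) ^ n k) ^ 8 *
      latticeConnectedCorr r.ρ (sch.β k) (sch.side k) r.curvature.F r.curvature.F (M ^ n k) :=
    hlim.eventually (lt_mem_nhds hθ2)
  -- … while the ceiling bound 1/(n_k+1) drops below θ/2
  have hev2 : ∀ᶠ k in atTop, 1 / ((n k : ℝ) + 1) < θ / 2 := by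
    have h0 : Tendsto (fun k => 1 / ((n k : ℝ) + 1)) atTop (𝓝 0) :=
      tendsto_one_div_add_atTop_nhds_zero_nat.comp hn
    exact h0.eventually (gt_mem_nhds (half_pos hθ))
  by_contra hcon
  obtain ⟨k, hk, hk1, hk2⟩ := ((not_eventually.1 hcon).and_eventually (hev1.and hev2)).exists
  have hβ : b (n k) (sch.L k) ≤ sch.β k := not_lt.1 hk
  have hc := hb (n k) (sch.L k) (sch.β k) hβ
  have hc' : ((M : ℝ) ^ n k) ^ 8 *
      latticeConnectedCorr r.ρ (sch.β k) (sch.side k) r.curvature.F r.curvature.F (M ^ n k) <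
        1 / ((n k : ℝ) + 1) := lt_of_le_of_lt (le_abs_self _) hc
  linarith

/-- The strengthening of the crux body in which the couplings may be required to DOMINATE any
prescribed function of the lattice data `(n_k, L_k)` (clause (iii) and `β_k → ∞` dropped — they
only weaken the statement refuted). -/
def WindowDominating (r : LatticeRep G) (M : ℕ) : Prop :=
  ∀ f : ℕ → ℕ → ℝ, ∃ θ₀ : ℝ, 0 < θ₀ ∧ ∀ θ : ℝ, 0 < θ → θ < θ₀ →
    ∃ (sch : SpeciesScheme (YMSpecies G)) (n : ℕ → ℕ),
      (∀ k, sch.a k = ((M : ℝ) ^ n k)⁻¹) ∧ (∀ k, f (n k) (sch.L k) ≤ sch.β k) ∧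
      Tendsto (fun k => ((M : ℝ) ^ n k) ^ 8 *
          latticeConnectedCorr r.ρ (sch.β k) (sch.side k) r.curvature.F r.curvature.F
            (M ^ n k)) atTop (𝓝 θ)

/-- **Refutation of the "free divergence" strengthening**: for every `G`, `r` and `M ≥ 2` there is a
growth requirement `β_k ≥ f(n_k, L_k)` incompatible with tuning. -/
theorem not_windowDominating (r : LatticeRep G) {M : ℕ} (hM : 2 ≤ M) : ¬ WindowDominating r M := by
  intro h
  obtain ⟨b, hb⟩ := eventually_beta_lt_ceiling r hM
  obtain ⟨θ₀, hθ₀, h⟩ := h b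
  obtain ⟨sch, n, hshape, hdom, hlim⟩ := h (θ₀ / 2) (by positivity) (by linarith)
  obtain ⟨k, hk⟩ := (hb sch n (θ₀ / 2) (by positivity) hshape hlim).exists
  exact absurd (hdom k) (not_le.2 hk)

/-- Global form: the crux with "`β_k → ∞`" strengthened to "`β_k` dominates any prescribed function
of the lattice data". -/
def TunedSequenceExistsDominating : Prop :=
  ∀ (G : Type) [Group G] [TopologicalSpace G] [IsTopologicalGroup G] [CompactSpace G],
    IsCompactSimpleLieGroup G → letI : MeasurableSpace G := borel G
    haveI : BorelSpace G := ⟨rfl⟩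
    ∀ (r : LatticeRep G) (M : ℕ), 2 ≤ M → WindowDominating r M

omit [Group G] [TopologicalSpace G] [IsTopologicalGroup G] [CompactSpace G] [MeasurableSpace G]
  [BorelSpace G] in
/-- **The strengthened crux is false as soon as one compact simple Lie group exists** (e.g. `SU(2)`,
via the tree's named fact `isSimpleCompactGroup_specialUnitaryGroup`; stated relative to any
inhabitant to stay unconditional). -/
theorem not_tunedSequenceExistsDominating_of {H : Type} [Group H] [TopologicalSpace H]
    [IsTopologicalGroup H] [CompactSpace H] (hH : IsCompactSimpleLieGroup H) :
    ¬ TunedSequenceExistsDominating := by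
  intro h
  obtain ⟨r⟩ := hH.2
  letI : MeasurableSpace H := borel H
  haveI : BorelSpace H := ⟨rfl⟩
  exact not_windowDominating r le_rfl (h H hH r 2 le_rfl)

/-- In particular, modulo the tree's named fact that `SU(n)` is simple. -/
theorem not_tunedSequenceExistsDominating
    (h : Literature.MathematicalPhysics.QuantumLattice.isSimpleCompactGroup_specialUnitaryGroup.{0}) :
    ¬ TunedSequenceExistsDominating :=
  not_tunedSequenceExistsDominating_of (isCompactSimpleLieGroup_specialUnitaryGroup h le_rfl)

end Ceiling

/-! ## § BetaZero — the strong-coupling endpoint: exact vanishing at `β = 0`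

At `β = 0` the Wilson measure is product Haar measure, links are independent, and the curvature
correlator at separation `2 ≤ m ≤ S - 2` vanishes EXACTLY. Consequences: the IVT lower endpoint
`N_1(k, 0) = 0` for provers, and the unconditional kill `not_windowAtZero`: the clause
`β_k → ∞` cannot be replaced by `β_k = 0` (the (o) clause is load-bearing from below; gen 1 also
killed fixed small `β` conditionally on volume-uniform OS clustering). -/

section BetaZero

variable {G : Type} [Group G] [TopologicalSpace G] [IsTopologicalGroup G] [CompactSpace G]
  [MeasurableSpace G] [BorelSpace G] {N : ℕ}

omit [Group G] [IsTopologicalGroup G] [CompactSpace G] in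
/-- Normalised Haar measure is a probability measure. -/
theorem isProbabilityMeasure_haarProbability [Group G] [IsTopologicalGroup G] [CompactSpace G] :
    IsProbabilityMeasure (haarProbability G) := by
  refine ⟨?_⟩
  show Measure.haarMeasure ⊤ Set.univ = 1
  rw [← TopologicalSpace.PositiveCompacts.coe_top]
  exact Measure.haarMeasure_self

/-- **At `β = 0` the Wilson measure is product Haar measure.** -/
theorem wilsonMeasure_zero {S : ℕ} [NeZero S] (ρ : G →* Matrix (Fin N) (Fin N) ℂ) :
    wilsonMeasure (d := 4) (L := S) ρ 0 = Measure.pi fun _ : Edge 4 S => haarProbability G := by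
  haveI := isProbabilityMeasure_haarProbability (G := G)
  have hw : wilsonWeight (d := 4) (L := S) ρ 0 = Measure.pi fun _ : Edge 4 S => haarProbability G := by
    have h1 : (fun U : GaugeConfig 4 S G => ENNReal.ofReal (Real.exp (-0 * wilsonAction ρ U))) = 1 := by
      funext U; simp
    rw [wilsonWeight, h1, withDensity_one]
  have hZ : partitionFunction (d := 4) (L := S) ρ 0 = 1 := by
    rw [partitionFunction, hw, measure_univ]
  rw [wilsonMeasure, hZ, inv_one, one_smul, hw]

omit [Group G] [TopologicalSpace G] [IsTopologicalGroup G] [CompactSpace G] [MeasurableSpace G]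
  [BorelSpace G] in
/-- A cylinder observable read on the periodic lift depends only on the image torus edges. -/
theorem dependsOn_comp_torusLift {S : ℕ} {A : LGConfig 4 G → ℝ}
    {s : Finset (Literature.MathematicalPhysics.QuantumLattice.ZdEdge 4)} (hA : IsCylinder A s) :
    DependsOn (fun U : GaugeConfig 4 S G => A (torusLift S U)) ↑(s.image (torusEdge S)) := by
  intro U V h
  refine hA fun e he => ?_
  simp only [torusLift, Function.comp_apply]
  exact h (torusEdge S e) (Finset.mem_coe.2 (Finset.mem_image_of_mem _ (Finset.mem_coe.1 he)))

/-- **At `β = 0`, observables with torus-disjoint supports are uncorrelated** (product Haar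
measure: independence over disjoint edge sets, plus translation invariance for the subtracted
term). -/
theorem latticeConnectedCorr_zero_of_disjoint [SecondCountableTopology G] {S : ℕ} [NeZero S]
    (ρ : G →* Matrix (Fin N) (Fin N) ℂ) {A B : LGConfig 4 G → ℝ} {sA sB : Finset (Literature.MathematicalPhysics.QuantumLattice.ZdEdge 4)}
    (hA : IsCylinder A sA) (hB : IsCylinder B sB) (hAm : Measurable A) (hBm : Measurable B)
    (m : ℕ)
    (hdisj : Disjoint (sA.image (torusEdge S))
      ((sB.image fun e => (e.1 - (-Pi.single 0 (m : ℤ)), e.2)).image (torusEdge S))) :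
    latticeConnectedCorr ρ 0 S A B m = 0 := by
  classical
  haveI := isProbabilityMeasure_haarProbability (G := G)
  -- translation invariance of the subtracted term (at any β; here β = 0)
  have hshift : ∫ U, B (configShift (-Pi.single 0 (m : ℤ)) (torusLift S U))
      ∂(wilsonMeasure (d := 4) (L := S) ρ 0) = ∫ U, B (torusLift S U) ∂(wilsonMeasure ρ 0) := by
    have h := wilsonExpectation_comp_torusConfigShift (d := 4) (L := S) ρ 0
      (Literature.Probability.LatticeModels.Torus.proj S (-Pi.single 0 (m : ℤ)))
      (toTorusObservable S B)
    rw [← toTorusObservable_comp_configShift] at h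
    simpa [wilsonExpectation, toTorusObservable] using h
  -- independence of the two factors under product Haar measure
  have hfac : ∫ U, A (torusLift S U) * B (configShift (-Pi.single 0 (m : ℤ)) (torusLift S U))
      ∂(wilsonMeasure (d := 4) (L := S) ρ 0) =
      (∫ U, A (torusLift S U) ∂(wilsonMeasure (d := 4) (L := S) ρ 0)) *
        ∫ U, B (configShift (-Pi.single 0 (m : ℤ)) (torusLift S U))
          ∂(wilsonMeasure (d := 4) (L := S) ρ 0) := by
    rw [wilsonMeasure_zero, ← Measure.infinitePi_eq_pi]
    refine Literature.Probability.LatticeModels.integral_mul_eq_of_dependsOn_disjoint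
      (fun _ : Edge 4 S => haarProbability G) hdisj ?_ ?_ ?_ ?_
    · exact hAm.comp (measurable_torusLift S)
    · exact (hBm.comp (configShift _).measurable).comp (measurable_torusLift S)
    · exact dependsOn_comp_torusLift hA
    · simpa [Function.comp_def] using
        dependsOn_comp_torusLift (S := S) (IsCylinder.comp_configShift hB (-Pi.single 0 (m : ℤ)))
  unfold latticeConnectedCorr
  rw [hfac, hshift, sub_self]

omit [TopologicalSpace G] [IsTopologicalGroup G] [CompactSpace G] [BorelSpace G] in
/-- Edges in the support of the curvature species have time coordinate `0` or `1`. -/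
theorem time_coord_of_mem_curvature_supp [TopologicalSpace G] [IsTopologicalGroup G]
    [CompactSpace G] [BorelSpace G] (r : LatticeRep G) {e : Literature.MathematicalPhysics.QuantumLattice.ZdEdge 4}
    (he : e ∈ r.curvature.supp) : e.1 0 = 0 ∨ e.1 0 = 1 := by
  have hsupp : r.curvature.supp =
      Finset.univ.biUnion fun p : Fin 4 × Fin 4 => originPlaquetteSupport p.1 p.2 := rfl
  rw [hsupp, Finset.mem_biUnion] at he
  obtain ⟨p, -, hp⟩ := he
  simp only [originPlaquetteSupport, Finset.mem_insert, Finset.mem_singleton] at hp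
  rcases hp with rfl | rfl | rfl | rfl
  · left; rfl
  · simp [Pi.single_apply]
    by_cases h : (0 : Fin 4) = p.1 <;> simp [h]
  · simp [Pi.single_apply]
    by_cases h : (0 : Fin 4) = p.2 <;> simp [h]
  · left; rfl

/-- The curvature supports at the origin and at `m e₀` are torus-disjoint when `2 ≤ m` and
`m + 2 ≤ S`. -/
theorem disjoint_curvature_supp (r : LatticeRep G) {S m : ℕ} (hm : 2 ≤ m) (hmS : m + 2 ≤ S) :
    Disjoint (r.curvature.supp.image (torusEdge S))
      ((r.curvature.supp.image fun e => (e.1 - (-Pi.single 0 (m : ℤ)), e.2)).image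
        (torusEdge S)) := by
  classical
  rw [Finset.disjoint_left]
  rintro f hf hf'
  obtain ⟨e, he, rfl⟩ := Finset.mem_image.1 hf
  obtain ⟨g, hg, hfg⟩ := Finset.mem_image.1 hf'
  obtain ⟨e', he', rfl⟩ := Finset.mem_image.1 hg
  -- compare time coordinates modulo S
  have h0 : (Literature.Probability.LatticeModels.Torus.proj S (e'.1 - -Pi.single 0 (m : ℤ))) 0 =
      (Literature.Probability.LatticeModels.Torus.proj S e.1) 0 := by
    have := congrArg (fun x : Edge 4 S => x.1 0) hfg
    simpa [torusEdge] using this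
  simp only [Literature.Probability.LatticeModels.Torus.proj_apply, sub_neg_eq_add, Pi.add_apply,
    Pi.single_eq_same] at h0
  push_cast at h0
  have hdvd : (S : ℤ) ∣ (e'.1 0 + m - e.1 0) := by
    have h1 : ((e'.1 0 + m - e.1 0 : ℤ) : ZMod S) = 0 := by
      push_cast
      rw [← h0]; ring
    exact (ZMod.intCast_zmod_eq_zero_iff_dvd _ S).1 h1
  have hpos : 0 < e'.1 0 + m - e.1 0 := by
    rcases time_coord_of_mem_curvature_supp r he with h | h <;>
      rcases time_coord_of_mem_curvature_supp r he' with h' | h' <;> omega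
  have hlt : e'.1 0 + m - e.1 0 < S := by
    rcases time_coord_of_mem_curvature_supp r he with h | h <;>
      rcases time_coord_of_mem_curvature_supp r he' with h' | h' <;> omega
  have := Int.le_of_dvd hpos hdvd
  omega

/-- **At `β = 0` the curvature correlator vanishes exactly** for separations `2 ≤ m ≤ S - 2`
(independent Haar links; the IVT lower endpoint `N_1(k, 0) = 0`). -/
theorem latticeConnectedCorr_curvature_zero (r : LatticeRep G) {S m : ℕ} [NeZero S]
    (hm : 2 ≤ m) (hmS : m + 2 ≤ S) :
    latticeConnectedCorr r.ρ 0 S r.curvature.F r.curvature.F m = 0 := by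
  haveI : SecondCountableTopology G :=
    (r.continuous.isClosedEmbedding r.injective).isEmbedding.secondCountableTopology
  exact latticeConnectedCorr_zero_of_disjoint r.ρ r.curvature.isCylinder r.curvature.isCylinder
    r.curvature.measurable r.curvature.measurable m (disjoint_curvature_supp r hm hmS)


/-- The crux body with `β_k → ∞` REPLACED by `β_k = 0` (clause (iii) dropped as well). -/
def WindowAtZero (r : LatticeRep G) (M : ℕ) : Prop :=
  ∃ θ₀ : ℝ, 0 < θ₀ ∧ ∀ θ : ℝ, 0 < θ → θ < θ₀ →
    ∃ (sch : SpeciesScheme (YMSpecies G)) (n : ℕ → ℕ),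
      (∀ k, sch.a k = ((M : ℝ) ^ n k)⁻¹) ∧ (∀ k, sch.β k = 0) ∧
      Tendsto (fun k => ((M : ℝ) ^ n k) ^ 8 *
          latticeConnectedCorr r.ρ (sch.β k) (sch.side k) r.curvature.F r.curvature.F
            (M ^ n k)) atTop (𝓝 θ)

/-- **No witness at infinite bare coupling**: for every `G`, `r`, `M ≥ 2` the `β = 0` variant of
the crux body is false (`N_1(k) = 0` eventually). -/
theorem not_windowAtZero (r : LatticeRep G) {M : ℕ} (hM : 2 ≤ M) : ¬ WindowAtZero r M := by
  rintro ⟨θ₀, hθ₀, h⟩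
  obtain ⟨sch, n, hshape, hβ0, hlim⟩ := h (θ₀ / 2) (by positivity) (by linarith)
  have hev : ∀ᶠ k in atTop, ((M : ℝ) ^ n k) ^ 8 *
      latticeConnectedCorr r.ρ (sch.β k) (sch.side k) r.curvature.F r.curvature.F (M ^ n k) =
        0 := by
    filter_upwards [eventually_sep_le_L sch hshape 1,
      (tendsto_exponent_of_shape hM sch hshape).eventually_ge_atTop 1] with k hk1 hk2
    have h2 : 2 ≤ M ^ n k :=
      calc 2 ≤ M := hM
        _ = M ^ 1 := (pow_one M).symm
        _ ≤ M ^ n k := Nat.pow_le_pow_right (by omega) hk2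
    have hside : sch.side k = 2 * sch.L k + 1 := rfl
    have hmS : M ^ n k + 2 ≤ sch.side k := by rw [hside]; omega
    rw [hβ0 k, latticeConnectedCorr_curvature_zero r h2 hmS, mul_zero]
  have h0 : Tendsto (fun k => ((M : ℝ) ^ n k) ^ 8 *
      latticeConnectedCorr r.ρ (sch.β k) (sch.side k) r.curvature.F r.curvature.F (M ^ n k))
      atTop (𝓝 0) :=
    tendsto_const_nhds.congr' (hev.mono fun k hk => hk.symm)
  have := tendsto_nhds_unique hlim h0
  linarith

end BetaZero

/-! ## § Glue — β-continuity on a fixed torus, and the exact reduction of the weak crux body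
to the finite-volume correlator window lower bound

With `latticeConnectedCorr_curvature_tendsto_zero` (upper endpoint) and β-continuity (below), the
intermediate value theorem turns "the rescaled correlator is `≥ θ₀` somewhere beyond every `B`, at
arbitrarily fine lattices and large tori" into an EXACTLY tuned witness, and conversely a tuned
witness exhibits such points. So `WindowWeak r M ↔ CorrelatorWindowLowerBound r M` (`M ≥ 2`):
modulo the a-priori bound of § ClauseThree, the crux IS the quantitative finite-volume form of
`ξ(β) → ∞` (Chatterjee, arXiv:1803.01950, Problem 5.1) — no `β = 0` endpoint, no reflection
positivity and no monotonicity in `β` are needed for this equivalence. -/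

section Glue

variable {X : Type*} [TopologicalSpace X] [CompactSpace X] [MeasurableSpace X]
  [OpensMeasurableSpace X]

/-- Laplace-type integrals `β ↦ ∫ g e^{-βS} dμ` are continuous (dominated convergence, locally
uniform domination by `sup|g| · e^{(|β₀|+1) sup|S|}`). -/
theorem continuous_laplaceIntegral (μ : Measure X) [IsFiniteMeasure μ] {S g : X → ℝ}
    (hS : Continuous S) (hg : Continuous g) :
    Continuous fun β : ℝ => ∫ x, g x * Real.exp (-β * S x) ∂μ := by
  obtain ⟨CS, hCS⟩ := isCompact_univ.exists_bound_of_continuousOn hS.continuousOn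
  obtain ⟨Cg, hCg⟩ := isCompact_univ.exists_bound_of_continuousOn hg.continuousOn
  refine continuous_iff_continuousAt.2 fun β₀ => ?_
  have hmeas : ∀ β : ℝ, AEStronglyMeasurable (fun x => g x * Real.exp (-β * S x)) μ := fun β =>
    (hg.mul (Real.continuous_exp.comp (continuous_const.mul hS))).aestronglyMeasurable
  refine continuousAt_of_dominated (bound := fun _ => Cg * Real.exp ((|β₀| + 1) * CS))
    (Eventually.of_forall hmeas) ?_ (integrable_const _) ?_
  · have hball : ∀ᶠ β in 𝓝 β₀, |β| ≤ |β₀| + 1 := by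
      filter_upwards [Metric.ball_mem_nhds β₀ one_pos] with β hβ
      have : |β - β₀| < 1 := by simpa [Real.dist_eq] using hβ
      have h1 := abs_sub_abs_le_abs_sub β β₀
      linarith
    filter_upwards [hball] with β hβ
    refine ae_of_all _ fun x => ?_
    have hgx : |g x| ≤ Cg := by simpa [Real.norm_eq_abs] using hCg x (Set.mem_univ x)
    have hSx : |S x| ≤ CS := by simpa [Real.norm_eq_abs] using hCS x (Set.mem_univ x)
    have hCg0 : 0 ≤ Cg := (abs_nonneg _).trans hgx
    rw [norm_mul, Real.norm_eq_abs, Real.norm_eq_abs, Real.abs_exp]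
    refine mul_le_mul hgx (Real.exp_le_exp.2 ?_) (Real.exp_pos _).le hCg0
    calc -β * S x ≤ |-β * S x| := le_abs_self _
      _ = |β| * |S x| := by rw [abs_mul, abs_neg]
      _ ≤ (|β₀| + 1) * CS := mul_le_mul hβ hSx (abs_nonneg _) (by positivity)
  · exact ae_of_all _ fun x => by fun_prop

omit [CompactSpace X] in
/-- The Laplace partition function is positive (nonempty compact space, open-positive measure). -/
theorem laplacePartition_pos (μ : Measure X) [IsFiniteMeasure μ] [μ.IsOpenPosMeasure]
    [CompactSpace X] [Nonempty X] {S : X → ℝ} (hS : Continuous S) (β : ℝ) :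
    0 < ∫ x, Real.exp (-β * S x) ∂μ := by
  obtain ⟨CS, hCS⟩ := isCompact_univ.exists_bound_of_continuousOn hS.continuousOn
  have hlow : ∀ x, Real.exp (-(|β| * CS)) ≤ Real.exp (-β * S x) := fun x => by
    refine Real.exp_le_exp.2 ?_
    have hSx : |S x| ≤ CS := by simpa [Real.norm_eq_abs] using hCS x (Set.mem_univ x)
    have : |β * S x| ≤ |β| * CS := by rw [abs_mul]; exact mul_le_mul_of_nonneg_left hSx (abs_nonneg _)
    have := (abs_le.1 this).2
    linarith
  have hU : 0 < μ.real Set.univ :=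
    ENNReal.toReal_pos (isOpen_univ.measure_pos μ Set.univ_nonempty).ne' (measure_ne_top μ _)
  calc 0 < Real.exp (-(|β| * CS)) * μ.real Set.univ := mul_pos (Real.exp_pos _) hU
    _ = ∫ _x, Real.exp (-(|β| * CS)) ∂μ := by rw [integral_const, smul_eq_mul, mul_comm]
    _ ≤ ∫ x, Real.exp (-β * S x) ∂μ :=
        integral_mono (integrable_const _)
          (integrable_of_continuous μ (Real.continuous_exp.comp (continuous_const.mul hS))) hlow

variable {G : Type} [Group G] [TopologicalSpace G] [IsTopologicalGroup G] [CompactSpace G]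
  [MeasurableSpace G] [BorelSpace G] {N : ℕ}

/-- **Wilson expectations of continuous observables on a fixed torus are continuous in `β`.** -/
theorem continuous_integral_wilsonMeasure [SecondCountableTopology G] {S : ℕ} [NeZero S]
    (ρ : G →* Matrix (Fin N) (Fin N) ℂ) (hρ : Continuous ρ) {F : GaugeConfig 4 S G → ℝ}
    (hF : Continuous F) : Continuous fun β : ℝ => ∫ U, F U ∂(wilsonMeasure ρ β) := by
  haveI : (haarProbability G).IsOpenPosMeasure := by unfold haarProbability; infer_instance
  haveI : IsFiniteMeasure (haarProbability G) := by unfold haarProbability; infer_instance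
  haveI : Nonempty (GaugeConfig 4 S G) := ⟨fun _ => 1⟩
  simp only [integral_wilsonMeasure_eq_div ρ hρ]
  refine (continuous_laplaceIntegral _ (continuous_wilsonAction ρ hρ) hF).div ?_ fun β =>
    (laplacePartition_pos _ (continuous_wilsonAction ρ hρ) β).ne'
  simpa using continuous_laplaceIntegral (Measure.pi fun _ : Edge 4 S => haarProbability G)
    (continuous_wilsonAction ρ hρ) continuous_const (g := fun _ => (1 : ℝ))

/-- **The finite-torus curvature correlator is continuous in `β`.** -/
theorem continuous_latticeConnectedCorr_curvature (r : LatticeRep G) (S : ℕ) [NeZero S] (m : ℕ) :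
    Continuous fun β : ℝ => latticeConnectedCorr r.ρ β S r.curvature.F r.curvature.F m := by
  haveI : SecondCountableTopology G := secondCountable_of_latticeRep r
  have hlift := continuous_torusLift (G := G) S
  have hA : Continuous fun U : GaugeConfig 4 S G => actionDensity r.ρ (torusLift S U) :=
    (continuous_actionDensity r.continuous).comp hlift
  have hB : Continuous fun U : GaugeConfig 4 S G =>
      actionDensity r.ρ (configShift (-Pi.single 0 (m : ℤ)) (torusLift S U)) :=
    (continuous_actionDensity r.continuous).comp ((continuous_configShift _).comp hlift)
  have h1 := continuous_integral_wilsonMeasure r.ρ r.continuous (hA.mul hB)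
  have h2 := continuous_integral_wilsonMeasure r.ρ r.continuous hA
  have hF : ∀ W, r.curvature.F W = actionDensity r.ρ W := fun W => rfl
  simp only [latticeConnectedCorr, hF]
  exact h1.sub (h2.mul h2)

/-- **The finite-volume correlator window lower bound** (gen 1's `CorrelatorWindowLowerBound`,
restated): some `θ₀ > 0` is reached by the rescaled curvature correlator beyond every coupling
`B`, at arbitrarily fine `M`-adic separations `M^m` and on arbitrarily large tori `2L+1`,
`L ≥ L₀ M^m`. This is the quantitative, finite-volume form of `ξ(β) → ∞` — the open input. -/
def CorrelatorWindowLowerBound (r : LatticeRep G) (M : ℕ) : Prop :=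
  ∃ θ₀ : ℝ, 0 < θ₀ ∧ ∀ (B : ℝ) (m₀ L₀ : ℕ), ∃ m : ℕ, m₀ ≤ m ∧ ∃ L : ℕ, L₀ * M ^ m ≤ L ∧
    ∃ β : ℝ, B ≤ β ∧ θ₀ ≤ ((M : ℝ) ^ m) ^ 8 *
      latticeConnectedCorr r.ρ β (2 * L + 1) r.curvature.F r.curvature.F (M ^ m)

/-- Exact tuning at one lattice: if the rescaled correlator is `≥ θ₀ > θ > 0` at `β*`, it equals `θ`
at some `β ≥ β*` (continuity + freezing + IVT). -/
theorem exists_ge_corr_eq (r : LatticeRep G) (M m L : ℕ) {θ θ₀ βstar : ℝ} (hθ : 0 < θ)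
    (hθθ₀ : θ < θ₀) (hstar : θ₀ ≤ ((M : ℝ) ^ m) ^ 8 *
      latticeConnectedCorr r.ρ βstar (2 * L + 1) r.curvature.F r.curvature.F (M ^ m)) :
    ∃ β : ℝ, βstar ≤ β ∧ ((M : ℝ) ^ m) ^ 8 *
      latticeConnectedCorr r.ρ β (2 * L + 1) r.curvature.F r.curvature.F (M ^ m) = θ := by
  set f : ℝ → ℝ := fun β => ((M : ℝ) ^ m) ^ 8 *
    latticeConnectedCorr r.ρ β (2 * L + 1) r.curvature.F r.curvature.F (M ^ m) with hf
  have hfc : Continuous f :=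
    continuous_const.mul (continuous_latticeConnectedCorr_curvature r (2 * L + 1) (M ^ m))
  have hlim : Tendsto f atTop (𝓝 0) := by
    have := (latticeConnectedCorr_curvature_tendsto_zero r (2 * L + 1) (M ^ m)).const_mul
      (((M : ℝ) ^ m) ^ 8)
    rwa [mul_zero] at this
  obtain ⟨β₂, hβ₂⟩ := eventually_atTop.1 ((hlim.eventually (gt_mem_nhds hθ)).and
    (eventually_ge_atTop βstar))
  obtain ⟨hlt, hge⟩ := hβ₂ β₂ le_rfl
  have hIVT := intermediate_value_Icc' hge hfc.continuousOn
  obtain ⟨β, hβmem, hβeq⟩ := hIVT ⟨hlt.le, by simpa [hf] using hθθ₀.le.trans hstar⟩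
  exact ⟨β, hβmem.1, hβeq⟩

/-- **Lower bound ⇒ weak crux body, with EXACT tuning** (`N_1(k) = θ` for all `k`). -/
theorem windowWeak_of_lowerBound (r : LatticeRep G) {M : ℕ} (hM : 2 ≤ M)
    (h : CorrelatorWindowLowerBound r M) : WindowWeak r M := by
  obtain ⟨θ₀, hθ₀, h⟩ := h
  refine ⟨θ₀, hθ₀, fun θ hθ hθθ₀ => ?_⟩
  -- at stage k demand: coupling ≥ k, exponent ≥ k, torus ≥ k · M^m
  choose m hm L hL βs hβs hcorr using fun k : ℕ => h (k : ℝ) k k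
  choose β hββs hβeq using fun k : ℕ => exists_ge_corr_eq r M (m k) (L k) hθ hθθ₀ (hcorr k)
  have hM1 : (1 : ℝ) < M := by exact_mod_cast hM
  have hMpos : (0 : ℝ) < M := by positivity
  -- the scheme
  have hm_top : Tendsto m atTop atTop := tendsto_atTop_mono hm tendsto_id
  have hpow_top : Tendsto (fun k => (M : ℝ) ^ m k) atTop atTop :=
    (tendsto_pow_atTop_atTop_of_one_lt hM1).comp hm_top
  let sch : SpeciesScheme (YMSpecies G) :=
    { a := fun k => ((M : ℝ) ^ m k)⁻¹
      a_pos := fun k => by positivity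
      tendsto_a := tendsto_inv_atTop_zero.comp hpow_top
      β := β
      L := L
      tendsto_L := by
        refine tendsto_atTop_mono (fun k => ?_) tendsto_natCast_atTop_atTop
        have hLk : (k : ℝ) * (M : ℝ) ^ m k ≤ L k := by exact_mod_cast hL k
        have hp : (0 : ℝ) < (M : ℝ) ^ m k := by positivity
        show (k : ℝ) ≤ ((M : ℝ) ^ m k)⁻¹ * (L k : ℝ)
        rw [inv_mul_eq_div, le_div_iff₀ hp]
        exact hLk
      c := fun _ _ => 0
      m := fun _ _ => 0 }
  refine ⟨sch, m, fun k => rfl, ?_, ?_⟩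
  · exact tendsto_atTop_mono (fun k => (hβs k).trans (hββs k)) tendsto_natCast_atTop_atTop
  · refine tendsto_const_nhds.congr fun k => ?_
    exact (hβeq k).symm

/-- **Weak crux body ⇒ lower bound** (constant `θ₀/4`, where `(0, θ₀)` is the window). -/
theorem lowerBound_of_windowWeak (r : LatticeRep G) {M : ℕ} (hM : 2 ≤ M) (h : WindowWeak r M) :
    CorrelatorWindowLowerBound r M := by
  obtain ⟨θ₀, hθ₀, h⟩ := h
  obtain ⟨sch, n, hshape, hβ, hlim⟩ := h (θ₀ / 2) (by positivity) (by linarith)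
  refine ⟨θ₀ / 4, by positivity, fun B m₀ L₀ => ?_⟩
  have hev1 : ∀ᶠ k in atTop, B ≤ sch.β k := tendsto_atTop.1 hβ B
  have hev2 : ∀ᶠ k in atTop, m₀ ≤ n k := tendsto_atTop.1 (tendsto_exponent_of_shape hM sch hshape) m₀
  have hev3 : ∀ᶠ k in atTop, L₀ * M ^ n k ≤ sch.L k := eventually_sep_le_L sch hshape L₀
  have hθ4 : θ₀ / 4 < θ₀ / 2 := by linarith
  have hev4 : ∀ᶠ k in atTop, θ₀ / 4 < ((M : ℝ) ^ n k) ^ 8 *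
      latticeConnectedCorr r.ρ (sch.β k) (sch.side k) r.curvature.F r.curvature.F (M ^ n k) :=
    hlim.eventually (lt_mem_nhds hθ4)
  obtain ⟨k, hk1, hk2, hk3, hk4⟩ := (hev1.and (hev2.and (hev3.and hev4))).exists
  exact ⟨n k, hk2, sch.L k, hk3, sch.β k, hk1, hk4.le⟩

/-- **The weak crux body IS the finite-volume correlator window lower bound.** -/
theorem windowWeak_iff_lowerBound (r : LatticeRep G) {M : ℕ} (hM : 2 ≤ M) :
    WindowWeak r M ↔ CorrelatorWindowLowerBound r M :=
  ⟨lowerBound_of_windowWeak r hM, windowWeak_of_lowerBound r hM⟩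

/-- **Dissection of the crux body**: `Window r M` follows from the open lower bound plus the
a-priori bound on `N_t`, and implies the lower bound. -/
theorem window_of_lowerBound_of_aprioriBound (r : LatticeRep G) {M : ℕ} (hM : 2 ≤ M)
    (hlb : CorrelatorWindowLowerBound r M) (hb : AprioriBound r M) : Window r M :=
  window_of_windowWeak_of_aprioriBound r M hb (windowWeak_of_lowerBound r hM hlb)

theorem lowerBound_of_window (r : LatticeRep G) {M : ℕ} (hM : 2 ≤ M) (h : Window r M) :
    CorrelatorWindowLowerBound r M :=
  lowerBound_of_windowWeak r hM (windowWeak_of_windowBdd r M (windowBdd_of_window r M h))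

/-- Global corollary: the crux implies the window lower bound for every compact simple `G`,
faithful unitary `r` and `M ≥ 2` — so a refutation of the (finite-volume, quantitative)
`ξ(β) → ∞` for ONE such datum refutes the crux. -/
theorem lowerBound_of_tunedSequenceExists (h : TunedSequenceExists) (G : Type) [Group G]
    [TopologicalSpace G] [IsTopologicalGroup G] [CompactSpace G] (hG : IsCompactSimpleLieGroup G) :
    letI : MeasurableSpace G := borel G
    haveI : BorelSpace G := ⟨rfl⟩
    ∀ (r : LatticeRep G) (M : ℕ), 2 ≤ M → CorrelatorWindowLowerBound r M := by
  letI : MeasurableSpace G := borel G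
  haveI : BorelSpace G := ⟨rfl⟩
  intro r M hM
  exact lowerBound_of_window r hM (tunedSequenceExists_iff.1 h G hG r M hM)

end Glue

/-! ## § Exponent — the canonical power `8 = 2·dim(tr F²)` is not load-bearing from above

Replace `(M^{n_k})^8` by `(M^{n_k})^p` in the tuning clause. For `p ≥ 8` the resulting weak body
`WindowWeakPow r M p` is IMPLIED by the crux body (via the lower bound: `θ₀ ≤ D⁸·corr` forces
`corr ≥ 0`, hence `θ₀ ≤ D^p·corr`; then freezing + continuity + IVT tune `D^p·corr` exactly), and
`WindowWeakPow r M p ↔ LowerBoundPow r M p` for every `p`. Reading: the tuning condition does not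
by itself detect the canonical scaling dimension — witnesses of the `p > 8` bodies have
`N_1(k) = θ·(M^{n_k})^{8-p} → 0`, i.e. they sit at the Gaussian end `g(ℓ_D) → 0` (useless for (A),
harmless for (S)). Refuting the `p < 8` bodies would need an a-priori canonical-scaling UPPER bound
`sup_{β ≥ B, D ≤ L} D⁸|⟨P ; τ_D P⟩| < ∞` (ultraviolet stability of the dimension-4 composite field),
which is not in the tree. -/

section Exponent

variable {G : Type} [Group G] [TopologicalSpace G] [IsTopologicalGroup G] [CompactSpace G]
  [MeasurableSpace G] [BorelSpace G]

/-- The weak crux body with exponent `p` in place of `8`. -/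
def WindowWeakPow (r : LatticeRep G) (M p : ℕ) : Prop :=
  ∃ θ₀ : ℝ, 0 < θ₀ ∧ ∀ θ : ℝ, 0 < θ → θ < θ₀ →
    ∃ (sch : SpeciesScheme (YMSpecies G)) (n : ℕ → ℕ),
      (∀ k, sch.a k = ((M : ℝ) ^ n k)⁻¹) ∧ Tendsto sch.β atTop atTop ∧
      Tendsto (fun k => ((M : ℝ) ^ n k) ^ p *
          latticeConnectedCorr r.ρ (sch.β k) (sch.side k) r.curvature.F r.curvature.F
            (M ^ n k)) atTop (𝓝 θ)

/-- The finite-volume window lower bound with exponent `p`. -/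
def LowerBoundPow (r : LatticeRep G) (M p : ℕ) : Prop :=
  ∃ θ₀ : ℝ, 0 < θ₀ ∧ ∀ (B : ℝ) (m₀ L₀ : ℕ), ∃ m : ℕ, m₀ ≤ m ∧ ∃ L : ℕ, L₀ * M ^ m ≤ L ∧
    ∃ β : ℝ, B ≤ β ∧ θ₀ ≤ ((M : ℝ) ^ m) ^ p *
      latticeConnectedCorr r.ρ β (2 * L + 1) r.curvature.F r.curvature.F (M ^ m)

theorem windowWeakPow_eight (r : LatticeRep G) (M : ℕ) : WindowWeakPow r M 8 ↔ WindowWeak r M :=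
  Iff.rfl

theorem lowerBoundPow_eight (r : LatticeRep G) (M : ℕ) :
    LowerBoundPow r M 8 ↔ CorrelatorWindowLowerBound r M :=
  Iff.rfl

/-- **Raising the exponent only weakens the lower bound** (`M ≥ 1`): a positive lower bound forces
the correlator to be non-negative at the chosen point, and `D^p ≤ D^q`. -/
theorem lowerBoundPow_mono (r : LatticeRep G) {M : ℕ} (hM : 1 ≤ M) {p q : ℕ} (hpq : p ≤ q)
    (h : LowerBoundPow r M p) : LowerBoundPow r M q := by
  obtain ⟨θ₀, hθ₀, h⟩ := h
  refine ⟨θ₀, hθ₀, fun B m₀ L₀ => ?_⟩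
  obtain ⟨m, hm, L, hL, β, hβ, hθ⟩ := h B m₀ L₀
  refine ⟨m, hm, L, hL, β, hβ, hθ.trans ?_⟩
  have hD : (1 : ℝ) ≤ (M : ℝ) ^ m := one_le_pow₀ (by exact_mod_cast hM)
  have hDp : (0 : ℝ) < ((M : ℝ) ^ m) ^ p := by positivity
  have hc : 0 ≤ latticeConnectedCorr r.ρ β (2 * L + 1) r.curvature.F r.curvature.F (M ^ m) := by
    by_contra hneg
    have : ((M : ℝ) ^ m) ^ p *
        latticeConnectedCorr r.ρ β (2 * L + 1) r.curvature.F r.curvature.F (M ^ m) < 0 :=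
      mul_neg_of_pos_of_neg hDp (not_le.1 hneg)
    linarith
  exact mul_le_mul_of_nonneg_right (pow_le_pow_right₀ hD hpq) hc

/-- Exact tuning at one lattice, exponent `p` (continuity + freezing + IVT). -/
theorem exists_ge_corr_eq_pow (r : LatticeRep G) (M m L p : ℕ) {θ θ₀ βstar : ℝ} (hθ : 0 < θ)
    (hθθ₀ : θ < θ₀) (hstar : θ₀ ≤ ((M : ℝ) ^ m) ^ p *
      latticeConnectedCorr r.ρ βstar (2 * L + 1) r.curvature.F r.curvature.F (M ^ m)) :
    ∃ β : ℝ, βstar ≤ β ∧ ((M : ℝ) ^ m) ^ p *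
      latticeConnectedCorr r.ρ β (2 * L + 1) r.curvature.F r.curvature.F (M ^ m) = θ := by
  set f : ℝ → ℝ := fun β => ((M : ℝ) ^ m) ^ p *
    latticeConnectedCorr r.ρ β (2 * L + 1) r.curvature.F r.curvature.F (M ^ m) with hf
  have hfc : Continuous f :=
    continuous_const.mul (continuous_latticeConnectedCorr_curvature r (2 * L + 1) (M ^ m))
  have hlim : Tendsto f atTop (𝓝 0) := by
    have := (latticeConnectedCorr_curvature_tendsto_zero r (2 * L + 1) (M ^ m)).const_mul
      (((M : ℝ) ^ m) ^ p)
    rwa [mul_zero] at this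
  obtain ⟨β₂, hβ₂⟩ := eventually_atTop.1 ((hlim.eventually (gt_mem_nhds hθ)).and
    (eventually_ge_atTop βstar))
  obtain ⟨hlt, hge⟩ := hβ₂ β₂ le_rfl
  have hIVT := intermediate_value_Icc' hge hfc.continuousOn
  obtain ⟨β, hβmem, hβeq⟩ := hIVT ⟨hlt.le, by simpa [hf] using hθθ₀.le.trans hstar⟩
  exact ⟨β, hβmem.1, hβeq⟩

/-- **Lower bound ⇒ weak body, any exponent** (exact tuning `(M^{n_k})^p · corr = θ`). -/
theorem windowWeakPow_of_lowerBoundPow (r : LatticeRep G) {M : ℕ} (hM : 2 ≤ M) (p : ℕ)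
    (h : LowerBoundPow r M p) : WindowWeakPow r M p := by
  obtain ⟨θ₀, hθ₀, h⟩ := h
  refine ⟨θ₀, hθ₀, fun θ hθ hθθ₀ => ?_⟩
  choose m hm L hL βs hβs hcorr using fun k : ℕ => h (k : ℝ) k k
  choose β hββs hβeq using fun k : ℕ => exists_ge_corr_eq_pow r M (m k) (L k) p hθ hθθ₀ (hcorr k)
  have hM1 : (1 : ℝ) < M := by exact_mod_cast hM
  have hm_top : Tendsto m atTop atTop := tendsto_atTop_mono hm tendsto_id
  have hpow_top : Tendsto (fun k => (M : ℝ) ^ m k) atTop atTop :=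
    (tendsto_pow_atTop_atTop_of_one_lt hM1).comp hm_top
  let sch : SpeciesScheme (YMSpecies G) :=
    { a := fun k => ((M : ℝ) ^ m k)⁻¹
      a_pos := fun k => by positivity
      tendsto_a := tendsto_inv_atTop_zero.comp hpow_top
      β := β
      L := L
      tendsto_L := by
        refine tendsto_atTop_mono (fun k => ?_) tendsto_natCast_atTop_atTop
        have hLk : (k : ℝ) * (M : ℝ) ^ m k ≤ L k := by exact_mod_cast hL k
        have hp : (0 : ℝ) < (M : ℝ) ^ m k := by positivity
        show (k : ℝ) ≤ ((M : ℝ) ^ m k)⁻¹ * (L k : ℝ)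
        rw [inv_mul_eq_div, le_div_iff₀ hp]
        exact hLk
      c := fun _ _ => 0
      m := fun _ _ => 0 }
  refine ⟨sch, m, fun k => rfl, ?_, ?_⟩
  · exact tendsto_atTop_mono (fun k => (hβs k).trans (hββs k)) tendsto_natCast_atTop_atTop
  · exact tendsto_const_nhds.congr fun k => (hβeq k).symm

/-- **Weak body ⇒ lower bound, any exponent.** -/
theorem lowerBoundPow_of_windowWeakPow (r : LatticeRep G) {M : ℕ} (hM : 2 ≤ M) (p : ℕ)
    (h : WindowWeakPow r M p) : LowerBoundPow r M p := by
  obtain ⟨θ₀, hθ₀, h⟩ := h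
  obtain ⟨sch, n, hshape, hβ, hlim⟩ := h (θ₀ / 2) (by positivity) (by linarith)
  refine ⟨θ₀ / 4, by positivity, fun B m₀ L₀ => ?_⟩
  have hev1 : ∀ᶠ k in atTop, B ≤ sch.β k := tendsto_atTop.1 hβ B
  have hev2 : ∀ᶠ k in atTop, m₀ ≤ n k :=
    tendsto_atTop.1 (tendsto_exponent_of_shape hM sch hshape) m₀
  have hev3 : ∀ᶠ k in atTop, L₀ * M ^ n k ≤ sch.L k := eventually_sep_le_L sch hshape L₀
  have hθ4 : θ₀ / 4 < θ₀ / 2 := by linarith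
  have hev4 : ∀ᶠ k in atTop, θ₀ / 4 < ((M : ℝ) ^ n k) ^ p *
      latticeConnectedCorr r.ρ (sch.β k) (sch.side k) r.curvature.F r.curvature.F (M ^ n k) :=
    hlim.eventually (lt_mem_nhds hθ4)
  obtain ⟨k, hk1, hk2, hk3, hk4⟩ := (hev1.and (hev2.and (hev3.and hev4))).exists
  exact ⟨n k, hk2, sch.L k, hk3, sch.β k, hk1, hk4.le⟩

/-- For every exponent the weak body IS the lower bound (`M ≥ 2`). -/
theorem windowWeakPow_iff_lowerBoundPow (r : LatticeRep G) {M : ℕ} (hM : 2 ≤ M) (p : ℕ) :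
    WindowWeakPow r M p ↔ LowerBoundPow r M p :=
  ⟨lowerBoundPow_of_windowWeakPow r hM p, windowWeakPow_of_lowerBoundPow r hM p⟩

/-- Weak bodies are monotone in the exponent: `p ≤ q` and `WindowWeakPow r M p` give
`WindowWeakPow r M q` (`M ≥ 2`). -/
theorem windowWeakPow_mono (r : LatticeRep G) {M : ℕ} (hM : 2 ≤ M) {p q : ℕ} (hpq : p ≤ q)
    (h : WindowWeakPow r M p) : WindowWeakPow r M q :=
  windowWeakPow_of_lowerBoundPow r hM q
    (lowerBoundPow_mono r (by omega) hpq (lowerBoundPow_of_windowWeakPow r hM p h))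

/-- **The exponent `8` is not load-bearing from above**: the crux body implies the weak body with
ANY exponent `p ≥ 8` (whose witnesses for `p > 8` drift to the Gaussian end, `N_1(k) → 0`). -/
theorem windowWeakPow_of_window (r : LatticeRep G) {M : ℕ} (hM : 2 ≤ M) {p : ℕ} (hp : 8 ≤ p)
    (h : Window r M) : WindowWeakPow r M p :=
  windowWeakPow_mono r hM hp
    ((windowWeakPow_eight r M).2 (windowWeak_of_windowBdd r M (windowBdd_of_window r M h)))

/-- Global form: the crux implies all its exponent-`p ≥ 8` weak variants. -/
theorem windowWeakPow_of_tunedSequenceExists (h : TunedSequenceExists) (G : Type) [Group G]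
    [TopologicalSpace G] [IsTopologicalGroup G] [CompactSpace G] (hG : IsCompactSimpleLieGroup G) :
    letI : MeasurableSpace G := borel G
    haveI : BorelSpace G := ⟨rfl⟩
    ∀ (r : LatticeRep G) (M p : ℕ), 2 ≤ M → 8 ≤ p → WindowWeakPow r M p := by
  letI : MeasurableSpace G := borel G
  haveI : BorelSpace G := ⟨rfl⟩
  intro r M p hM hp
  exact windowWeakPow_of_window r hM hp (tunedSequenceExists_iff.1 h G hG r M hM)

end Exponent

/-! ## § Uniform — quantifier swaps and the trivial a-priori bound -/

section Uniform

variable {G : Type} [Group G] [TopologicalSpace G] [IsTopologicalGroup G] [CompactSpace G]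
  [MeasurableSpace G] [BorelSpace G]

/-- **`∀ θ ∃ scheme` cannot be swapped to `∃ scheme ∀ θ`**: one tuned sequence has one limit. -/
theorem not_window_uniform (r : LatticeRep G) (M : ℕ) :
    ¬ (∃ θ₀ : ℝ, 0 < θ₀ ∧ ∃ (sch : SpeciesScheme (YMSpecies G)) (n : ℕ → ℕ),
        ∀ θ : ℝ, 0 < θ → θ < θ₀ →
          Tendsto (fun k => ((M : ℝ) ^ n k) ^ 8 *
              latticeConnectedCorr r.ρ (sch.β k) (sch.side k) r.curvature.F r.curvature.F
                (M ^ n k)) atTop (𝓝 θ)) := by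
  rintro ⟨θ₀, hθ₀, sch, n, h⟩
  have h1 := h (θ₀ / 2) (by positivity) (by linarith)
  have h2 := h (θ₀ / 4) (by positivity) (by linarith)
  have := tendsto_nhds_unique h1 h2
  linarith

/-- The only UNCONDITIONAL a-priori bound: `|⟨A ; τ_m B⟩| ≤ 2 C_A C_B` (probability measure,
bounded observables) — so `|N_t(k)| ≤ 2 C_P² (M^{n_k})^8`, useless for clause (iii); anything
better is transfer-operator positivity / clustering, i.e. real input (§ ClauseThree). -/
theorem abs_latticeConnectedCorr_le {N : ℕ} (ρ : G →* Matrix (Fin N) (Fin N) ℂ)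
    (hρ : Continuous ρ) (β : ℝ) (S : ℕ) [NeZero S] {A B : LGConfig 4 G → ℝ} {CA CB : ℝ}
    (hA : ∀ U, |A U| ≤ CA) (hB : ∀ U, |B U| ≤ CB) (m : ℕ) :
    |latticeConnectedCorr ρ β S A B m| ≤ 2 * (CA * CB) := by
  haveI := isProbabilityMeasure_wilsonMeasure (d := 4) (L := S) ρ hρ β
  have hCA : 0 ≤ CA := (abs_nonneg _).trans (hA fun _ => 1)
  have hCB : 0 ≤ CB := (abs_nonneg _).trans (hB fun _ => 1)
  have bound : ∀ (f : GaugeConfig 4 S G → ℝ) (C : ℝ), (∀ U, |f U| ≤ C) →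
      |∫ U, f U ∂(wilsonMeasure (d := 4) (L := S) ρ β)| ≤ C := fun f C hf => by
    calc |∫ U, f U ∂(wilsonMeasure ρ β)| ≤ ∫ U, |f U| ∂(wilsonMeasure ρ β) :=
          abs_integral_le_integral_abs
      _ ≤ ∫ _U, C ∂(wilsonMeasure ρ β) := by
          refine integral_mono_of_nonneg (ae_of_all _ fun U => abs_nonneg _)
            (integrable_const C) (ae_of_all _ fun U => hf U)
      _ = C := by simp
  have h1 := bound (fun U => A (torusLift S U) * B (configShift (-Pi.single 0 (m : ℤ))
    (torusLift S U))) (CA * CB) fun U => by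
      rw [abs_mul]; exact mul_le_mul (hA _) (hB _) (abs_nonneg _) hCA
  have h2 := bound (fun U => A (torusLift S U)) CA fun U => hA _
  have h3 := bound (fun U => B (torusLift S U)) CB fun U => hB _
  unfold latticeConnectedCorr
  calc |(∫ U, A (torusLift S U) * B (configShift (-Pi.single 0 (m : ℤ)) (torusLift S U))
          ∂wilsonMeasure ρ β) - (∫ U, A (torusLift S U) ∂wilsonMeasure ρ β) *
            ∫ U, B (torusLift S U) ∂wilsonMeasure ρ β|
      ≤ |∫ U, A (torusLift S U) * B (configShift (-Pi.single 0 (m : ℤ)) (torusLift S U))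
          ∂wilsonMeasure ρ β| + |(∫ U, A (torusLift S U) ∂wilsonMeasure ρ β) *
            ∫ U, B (torusLift S U) ∂wilsonMeasure ρ β| := abs_sub _ _
    _ ≤ CA * CB + CA * CB := by
        rw [abs_mul]
        exact add_le_add h1 (mul_le_mul h2 h3 (abs_nonneg _) hCA)
    _ = 2 * (CA * CB) := by ring

end Uniform

/-! ## § Clustering — uniform weak-coupling clustering kills the window (gen 3)

The contrapositive face of the open input. If for some `β₁`, `m > 0`, `C` the finite-torus
curvature correlator satisfied `|⟨P ; τ_D P⟩_{β, 2L+1}| ≤ C e^{-m D}` for ALL `β ≥ β₁`, all `L`, all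
`D ≤ L` — a lattice-units mass gap bounded below UNIFORMLY at weak coupling, with a uniform
amplitude — then no tuned witness exists: `|N_1(k)| ≤ C (M^{n_k})^8 e^{-m M^{n_k}} → 0`. Hence the
crux implies, for EVERY compact simple `G` and faithful unitary `r`, that no such uniform clustering
holds: the lattice correlation length is unbounded on every `[β₁, ∞)` (a weak form of `ξ(β) → ∞`,
Chatterjee arXiv:1803.01950 Problem 5.1 — open for every 4-d non-abelian `G`). This is also exactly
the mechanism by which the window is EMPTY for finite gauge groups (volume-uniform low-temperature
expansions with `β`-independent rate; barrier `DiscreteSubgroupFreezing`) — so `ConnectedSpace G`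
inside `IsSimpleCompactGroup` is load-bearing, modulo that textbook expansion (not in the tree).
Gen 1 had the fixed-`β` instance (`β_k ≡ β`, `FixedCouplingUltralocality`); this is the version
uniform on `[β₁, ∞)`, the one relevant once `β_k → ∞` is demanded. -/

section Clustering

variable {G : Type} [Group G] [TopologicalSpace G] [IsTopologicalGroup G] [CompactSpace G]
  [MeasurableSpace G] [BorelSpace G]

omit [Group G] [TopologicalSpace G] [IsTopologicalGroup G] [CompactSpace G] [MeasurableSpace G]
  [BorelSpace G] in
/-- `x^p · C e^{-m x} → 0` as `x → ∞` (`m > 0`). -/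
theorem tendsto_pow_mul_const_mul_exp_neg (p : ℕ) {m : ℝ} (hm : 0 < m) (C : ℝ) :
    Tendsto (fun x : ℝ => x ^ p * (C * Real.exp (-(m * x)))) atTop (𝓝 0) := by
  have h := (Real.tendsto_pow_mul_exp_neg_atTop_nhds_zero p).comp (tendsto_id.const_mul_atTop hm)
  have h2 := h.const_mul (C * (m ^ p)⁻¹)
  rw [mul_zero] at h2
  refine h2.congr fun x => ?_
  have hmp : (m ^ p)⁻¹ * m ^ p = 1 := inv_mul_cancel₀ (pow_ne_zero _ hm.ne')
  simp only [Function.comp_apply, id, mul_pow]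
  calc C * (m ^ p)⁻¹ * (m ^ p * x ^ p * Real.exp (-(m * x)))
      = ((m ^ p)⁻¹ * m ^ p) * (x ^ p * (C * Real.exp (-(m * x)))) := by ring
    _ = x ^ p * (C * Real.exp (-(m * x))) := by rw [hmp, one_mul]

/-- **Uniform exponential clustering at weak coupling** (lattice units): rate `m > 0` and
amplitude `C` uniform over `β ≥ β₁`, all odd tori and all separations in the half torus. -/
def UniformClustering (r : LatticeRep G) : Prop :=
  ∃ (β₁ m C : ℝ), 0 < m ∧ ∀ β : ℝ, β₁ ≤ β → ∀ L D : ℕ, D ≤ L →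
    |latticeConnectedCorr r.ρ β (2 * L + 1) r.curvature.F r.curvature.F D| ≤
      C * Real.exp (-(m * D))

/-- **Uniform weak-coupling clustering kills even the weak crux body** (`β_k → ∞` puts the
witness in the clustering regime; `D⁸ C e^{-mD} → 0` along `D = M^{n_k} → ∞`). -/
theorem not_windowWeak_of_uniformClustering (r : LatticeRep G) (M : ℕ) (hcl : UniformClustering r) :
    ¬ WindowWeak r M := by
  obtain ⟨β₁, m, C, hm, hcl⟩ := hcl
  rintro ⟨θ₀, hθ₀, h⟩
  obtain ⟨sch, n, hshape, hβ, hlim⟩ := h (θ₀ / 2) (by positivity) (by linarith)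
  have hu : Tendsto (fun k => ((M : ℝ) ^ n k) ^ 8 * (C * Real.exp (-(m * (M : ℝ) ^ n k))))
      atTop (𝓝 0) :=
    (tendsto_pow_mul_const_mul_exp_neg 8 hm C).comp (tendsto_pow_of_shape sch hshape)
  have hev1 : ∀ᶠ k in atTop, β₁ ≤ sch.β k := tendsto_atTop.1 hβ β₁
  have hev2 : ∀ᶠ k in atTop, 1 * M ^ n k ≤ sch.L k := eventually_sep_le_L sch hshape 1
  have hθ4 : (0 : ℝ) < θ₀ / 4 := by positivity
  have hev3 : ∀ᶠ k in atTop,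
      ((M : ℝ) ^ n k) ^ 8 * (C * Real.exp (-(m * (M : ℝ) ^ n k))) < θ₀ / 4 :=
    hu.eventually (gt_mem_nhds hθ4)
  have hθ42 : θ₀ / 4 < θ₀ / 2 := by linarith
  have hev4 : ∀ᶠ k in atTop, θ₀ / 4 < ((M : ℝ) ^ n k) ^ 8 *
      latticeConnectedCorr r.ρ (sch.β k) (sch.side k) r.curvature.F r.curvature.F (M ^ n k) :=
    hlim.eventually (lt_mem_nhds hθ42)
  obtain ⟨k, hk1, hk2, hk3, hk4⟩ := (hev1.and (hev2.and (hev3.and hev4))).exists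
  have hside : sch.side k = 2 * sch.L k + 1 := rfl
  have hb := hcl (sch.β k) hk1 (sch.L k) (M ^ n k) (by simpa using hk2)
  have hb' : |latticeConnectedCorr r.ρ (sch.β k) (sch.side k) r.curvature.F r.curvature.F
      (M ^ n k)| ≤ C * Real.exp (-(m * (M : ℝ) ^ n k)) := by
    simpa [Nat.cast_pow, hside] using hb
  have hpow : (0 : ℝ) ≤ ((M : ℝ) ^ n k) ^ 8 := by positivity
  have hle : ((M : ℝ) ^ n k) ^ 8 *
      latticeConnectedCorr r.ρ (sch.β k) (sch.side k) r.curvature.F r.curvature.F (M ^ n k) ≤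
      ((M : ℝ) ^ n k) ^ 8 * (C * Real.exp (-(m * (M : ℝ) ^ n k))) :=
    mul_le_mul_of_nonneg_left ((le_abs_self _).trans hb') hpow
  linarith

/-- The form in which low-temperature / contour expansions actually deliver clustering on a
torus: the bound is only claimed for tori large relative to the separation (`c₀ D ≤ L`, so that
wrapping vortices are negligible) — cf. `Negative.FiniteAbelianClustering`. -/
def UniformClusteringBeyond (r : LatticeRep G) : Prop :=
  ∃ (β₁ m C : ℝ) (c₀ : ℕ), 0 < m ∧ ∀ β : ℝ, β₁ ≤ β → ∀ L D : ℕ, c₀ * D ≤ L →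
    |latticeConnectedCorr r.ρ β (2 * L + 1) r.curvature.F r.curvature.F D| ≤
      C * Real.exp (-(m * D))

theorem uniformClusteringBeyond_of_uniformClustering (r : LatticeRep G) (h : UniformClustering r) :
    UniformClusteringBeyond r := by
  obtain ⟨β₁, m, C, hm, h⟩ := h
  exact ⟨β₁, m, C, 1, hm, fun β hβ L D hDL => h β hβ L D (by simpa using hDL)⟩

/-- **The thresholded form kills the weak body just the same** (the scheme's tori satisfy
`c₀ M^{n_k} ≤ L_k` eventually for every `c₀`, by `a_k L_k → ∞`). -/
theorem not_windowWeak_of_uniformClusteringBeyond (r : LatticeRep G) (M : ℕ)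
    (hcl : UniformClusteringBeyond r) : ¬ WindowWeak r M := by
  obtain ⟨β₁, m, C, c₀, hm, hcl⟩ := hcl
  rintro ⟨θ₀, hθ₀, h⟩
  obtain ⟨sch, n, hshape, hβ, hlim⟩ := h (θ₀ / 2) (by positivity) (by linarith)
  have hu : Tendsto (fun k => ((M : ℝ) ^ n k) ^ 8 * (C * Real.exp (-(m * (M : ℝ) ^ n k))))
      atTop (𝓝 0) :=
    (tendsto_pow_mul_const_mul_exp_neg 8 hm C).comp (tendsto_pow_of_shape sch hshape)
  have hev1 : ∀ᶠ k in atTop, β₁ ≤ sch.β k := tendsto_atTop.1 hβ β₁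
  have hev2 : ∀ᶠ k in atTop, c₀ * M ^ n k ≤ sch.L k := eventually_sep_le_L sch hshape c₀
  have hθ4 : (0 : ℝ) < θ₀ / 4 := by positivity
  have hev3 : ∀ᶠ k in atTop,
      ((M : ℝ) ^ n k) ^ 8 * (C * Real.exp (-(m * (M : ℝ) ^ n k))) < θ₀ / 4 :=
    hu.eventually (gt_mem_nhds hθ4)
  have hθ42 : θ₀ / 4 < θ₀ / 2 := by linarith
  have hev4 : ∀ᶠ k in atTop, θ₀ / 4 < ((M : ℝ) ^ n k) ^ 8 *
      latticeConnectedCorr r.ρ (sch.β k) (sch.side k) r.curvature.F r.curvature.F (M ^ n k) :=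
    hlim.eventually (lt_mem_nhds hθ42)
  obtain ⟨k, hk1, hk2, hk3, hk4⟩ := (hev1.and (hev2.and (hev3.and hev4))).exists
  have hside : sch.side k = 2 * sch.L k + 1 := rfl
  have hb := hcl (sch.β k) hk1 (sch.L k) (M ^ n k) hk2
  have hb' : |latticeConnectedCorr r.ρ (sch.β k) (sch.side k) r.curvature.F r.curvature.F
      (M ^ n k)| ≤ C * Real.exp (-(m * (M : ℝ) ^ n k)) := by
    simpa [Nat.cast_pow, hside] using hb
  have hpow : (0 : ℝ) ≤ ((M : ℝ) ^ n k) ^ 8 := by positivity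
  have hle : ((M : ℝ) ^ n k) ^ 8 *
      latticeConnectedCorr r.ρ (sch.β k) (sch.side k) r.curvature.F r.curvature.F (M ^ n k) ≤
      ((M : ℝ) ^ n k) ^ 8 * (C * Real.exp (-(m * (M : ℝ) ^ n k))) :=
    mul_le_mul_of_nonneg_left ((le_abs_self _).trans hb') hpow
  linarith

theorem not_window_of_uniformClusteringBeyond (r : LatticeRep G) (M : ℕ)
    (hcl : UniformClusteringBeyond r) : ¬ Window r M := fun h =>
  not_windowWeak_of_uniformClusteringBeyond r M hcl
    (windowWeak_of_windowBdd r M (windowBdd_of_window r M h))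

/-- The crux body verbatim dies as well. -/
theorem not_window_of_uniformClustering (r : LatticeRep G) (M : ℕ) (hcl : UniformClustering r) :
    ¬ Window r M := fun h =>
  not_windowWeak_of_uniformClustering r M hcl (windowWeak_of_windowBdd r M (windowBdd_of_window r M h))

/-- Equivalently the window forces the FAILURE of uniform clustering ("any proof of the crux proves
`ξ(β) → ∞` in this form"). -/
theorem not_uniformClustering_of_window (r : LatticeRep G) (M : ℕ) (h : Window r M) :
    ¬ UniformClustering r := fun hcl => not_window_of_uniformClustering r M hcl h

/-- Uniform clustering also refutes the lower bound directly (so it is the honest negation target: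
`¬(S)` for one datum ⟸ `UniformClustering` for that datum). -/
theorem not_lowerBound_of_uniformClustering (r : LatticeRep G) {M : ℕ} (hM : 2 ≤ M)
    (hcl : UniformClustering r) : ¬ CorrelatorWindowLowerBound r M := fun h =>
  not_windowWeak_of_uniformClustering r M hcl (windowWeak_of_lowerBound r hM h)

/-- **Global corollary: the crux implies that NO compact simple lattice gauge theory (Wilson action,
any faithful unitary `r`) clusters uniformly at weak coupling.** -/
theorem not_uniformClustering_of_tunedSequenceExists (h : TunedSequenceExists) (G : Type) [Group G]
    [TopologicalSpace G] [IsTopologicalGroup G] [CompactSpace G] (hG : IsCompactSimpleLieGroup G) :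
    letI : MeasurableSpace G := borel G
    haveI : BorelSpace G := ⟨rfl⟩
    ∀ r : LatticeRep G, ¬ UniformClustering r := by
  letI : MeasurableSpace G := borel G
  haveI : BorelSpace G := ⟨rfl⟩
  intro r
  exact not_uniformClustering_of_window r 2 (tunedSequenceExists_iff.1 h G hG r 2 le_rfl)

end Clustering

/-! ## § Faithful — the representation datum must be faithful (gen 3)

With `r : LatticeRep G` replaced by an arbitrary continuous unitary `ρ : G →* U(N)` (injectivity
dropped; the curvature observable is `actionDensity ρ`, which IS `r.curvature.F` for a lattice
representation), the crux is false: in the trivial representation the action density is constant and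
every connected correlator vanishes. "Any proof must use that `P` fluctuates", i.e. faithfulness (or
at least non-triviality) of `ρ`; junk sizes `N = 0, 1` are excluded for `LatticeRep` only through
injectivity + non-abelianness. -/

section Faithful

variable {G : Type} [Group G] [TopologicalSpace G] [IsTopologicalGroup G] [CompactSpace G]
  [MeasurableSpace G] [BorelSpace G] {N : ℕ}

/-- The curvature observable of a lattice representation is the action density of its `ρ`. -/
theorem curvature_F_eq (r : LatticeRep G) : r.curvature.F = actionDensity r.ρ := rfl

omit [TopologicalSpace G] [IsTopologicalGroup G] [CompactSpace G] [MeasurableSpace G]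
  [BorelSpace G] in
/-- In the trivial representation the action density is constant. -/
theorem actionDensity_one (U V : LGConfig 4 G) :
    actionDensity (1 : G →* Matrix (Fin N) (Fin N) ℂ) U =
      actionDensity (1 : G →* Matrix (Fin N) (Fin N) ℂ) V := by
  simp [actionDensity, plaquetteObs]

/-- In the trivial representation every connected curvature correlator vanishes (any `β`, torus,
separation). -/
theorem latticeConnectedCorr_actionDensity_one (β : ℝ) (S : ℕ) [NeZero S] (m : ℕ) :
    latticeConnectedCorr (1 : G →* Matrix (Fin N) (Fin N) ℂ) β S
      (actionDensity (1 : G →* Matrix (Fin N) (Fin N) ℂ))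
      (actionDensity (1 : G →* Matrix (Fin N) (Fin N) ℂ)) m = 0 := by
  haveI := isProbabilityMeasure_wilsonMeasure (d := 4) (L := S)
    (1 : G →* Matrix (Fin N) (Fin N) ℂ) continuous_const β
  set U₀ : LGConfig 4 G := fun _ => 1
  have hA : ∀ V, actionDensity (1 : G →* Matrix (Fin N) (Fin N) ℂ) V =
      actionDensity (1 : G →* Matrix (Fin N) (Fin N) ℂ) U₀ := fun V => actionDensity_one V U₀
  unfold latticeConnectedCorr
  simp only [hA, integral_const, smul_eq_mul, probReal_univ]
  ring

/-- The crux body over a bare (not necessarily faithful) representation `ρ`. -/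
def WindowRho (ρ : G →* Matrix (Fin N) (Fin N) ℂ) (M : ℕ) : Prop :=
  ∃ θ₀ : ℝ, 0 < θ₀ ∧ ∀ θ : ℝ, 0 < θ → θ < θ₀ →
    ∃ (sch : SpeciesScheme (YMSpecies G)) (n : ℕ → ℕ),
      (∀ k, sch.a k = ((M : ℝ) ^ n k)⁻¹) ∧ Tendsto sch.β atTop atTop ∧
      (∀ t : ℕ, 0 < t → ∃ c : ℝ, Tendsto (fun k => ((M : ℝ) ^ n k) ^ 8 *
          latticeConnectedCorr ρ (sch.β k) (sch.side k) (actionDensity ρ) (actionDensity ρ)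
            (t * M ^ n k)) atTop (𝓝 c)) ∧
      Tendsto (fun k => ((M : ℝ) ^ n k) ^ 8 *
          latticeConnectedCorr ρ (sch.β k) (sch.side k) (actionDensity ρ) (actionDensity ρ)
            (M ^ n k)) atTop (𝓝 θ)

/-- For a lattice representation, `WindowRho r.ρ` is the crux body (definitionally). -/
theorem windowRho_iff_window (r : LatticeRep G) (M : ℕ) : WindowRho r.ρ M ↔ Window r M := Iff.rfl

/-- **The trivial representation has an empty window** (every `G`, `N`, `M`): `N_1(k) ≡ 0`. -/
theorem not_windowRho_one (M : ℕ) : ¬ WindowRho (1 : G →* Matrix (Fin N) (Fin N) ℂ) M := by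
  rintro ⟨θ₀, hθ₀, h⟩
  obtain ⟨sch, n, -, -, -, hlim⟩ := h (θ₀ / 2) (by positivity) (by linarith)
  have h0 : Tendsto (fun k => ((M : ℝ) ^ n k) ^ 8 *
      latticeConnectedCorr (1 : G →* Matrix (Fin N) (Fin N) ℂ) (sch.β k) (sch.side k)
        (actionDensity (1 : G →* Matrix (Fin N) (Fin N) ℂ))
        (actionDensity (1 : G →* Matrix (Fin N) (Fin N) ℂ)) (M ^ n k)) atTop (𝓝 0) := by
    simp only [latticeConnectedCorr_actionDensity_one, mul_zero]
    exact tendsto_const_nhds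
  have := tendsto_nhds_unique hlim h0
  linarith

/-- The crux with faithfulness of the representation DROPPED (any continuous unitary `ρ`). -/
def TunedSequenceExistsUnfaithful : Prop :=
  ∀ (G : Type) [Group G] [TopologicalSpace G] [IsTopologicalGroup G] [CompactSpace G],
    IsCompactSimpleLieGroup G → letI : MeasurableSpace G := borel G
    haveI : BorelSpace G := ⟨rfl⟩
    ∀ (N : ℕ) (ρ : G →* Matrix (Fin N) (Fin N) ℂ), Continuous ρ →
      (∀ g, ρ g ∈ Matrix.unitaryGroup (Fin N) ℂ) → ∀ M : ℕ, 2 ≤ M → WindowRho ρ M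

omit [Group G] [TopologicalSpace G] [IsTopologicalGroup G] [CompactSpace G] [MeasurableSpace G]
  [BorelSpace G] in
/-- **Any proof of (S) must use faithfulness (non-triviality) of `r`**: the unfaithful variant is
false as soon as one compact simple Lie group exists (witness: its trivial character, `M = 2`). -/
theorem not_tunedSequenceExistsUnfaithful_of {H : Type} [Group H] [TopologicalSpace H]
    [IsTopologicalGroup H] [CompactSpace H] (hH : IsCompactSimpleLieGroup H) :
    ¬ TunedSequenceExistsUnfaithful := by
  intro h
  letI : MeasurableSpace H := borel H
  haveI : BorelSpace H := ⟨rfl⟩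
  have hu : ∀ g : H, (1 : H →* Matrix (Fin 1) (Fin 1) ℂ) g ∈ Matrix.unitaryGroup (Fin 1) ℂ :=
    fun g => by simp
  exact not_windowRho_one (G := H) (N := 1) 2 (h H hH 1 1 continuous_const hu 2 le_rfl)

/-- In particular, modulo the tree's named fact that `SU(n)` is simple. -/
theorem not_tunedSequenceExistsUnfaithful
    (h : Literature.MathematicalPhysics.QuantumLattice.isSimpleCompactGroup_specialUnitaryGroup.{0}) :
    ¬ TunedSequenceExistsUnfaithful :=
  not_tunedSequenceExistsUnfaithful_of (isCompactSimpleLieGroup_specialUnitaryGroup h le_rfl)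

end Faithful

/-! ## § FiniteGroups — discrete gauge groups freeze: the window is EMPTY for finite abelian `G`
(gen 3, UNCONDITIONAL; landed as `Negative.FiniteAbelianClustering` p71622 +
`Negative.FiniteGroupFalse` p71819 — import them for the theorems; this workfile only records the
statements, to stay light)

`Negative.FiniteGroupFalse.window_false_of_finite_abelian`: for every finite abelian non-trivial
`G` (discrete topology), every faithful unitary `r` and every `M`, `¬ Window r M` — `β_k → ∞`
drives any would-be witness into the Higgs/freezing regime of the tree's Kotecký–Preiss contour
expansion (`abelianHiggs_torus_clustering`, re-assembled in `Negative.FiniteAbelianClustering`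
with `β`-UNIFORM constants and an EXPLICIT volume condition, needed because a tuned witness varies
`β_k` and `L_k` together; the action gap is automatic for a faithful unitary representation of a
finite group), where `|⟨P ; τ_D P⟩_{β, 2L+1}| ≤ C e^{-D}` with `C` independent of `β` and of the
volume, so `N_1(k) ≤ C (M^{n_k})^8 e^{-M^{n_k}} → 0`: an unconditional instance of § Clustering's
mechanism (`UniformClusteringBeyond` form) and the formal bite of `DiscreteSubgroupFreezing`.
`Negative.FiniteGroupFalse.tunedSequenceExists_nontrivial_false`: hence the `Nontrivial` weakening
below is FALSE (witness `ℤ₂ ⊂ U(1)`), which the trivial-group kill of § LoadBearing does not reach.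
Which clause of `IsSimpleCompactGroup` is isolated: `ℤ_n` violates both `ConnectedSpace` and
non-commutativity; the finite NON-abelian subgroups of `SU(2)` (binary polyhedral groups) satisfy
every clause except `ConnectedSpace` and are expected to freeze identically, but the tree's
expansion is abelian — that instance stays open here, as does `U(1)` (connected abelian; physically
`N_1 ≈ c₀/β² → 0`, needs spin-wave bounds). -/

section FiniteGroups

/-- The crux with `IsCompactSimpleLieGroup G` weakened to `Nontrivial G` — refuted (definitionally
this statement) by `Negative.FiniteGroupFalse.tunedSequenceExists_nontrivial_false`. -/
def TunedSequenceExistsNontrivial : Prop :=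
  ∀ (G : Type) [Group G] [TopologicalSpace G] [IsTopologicalGroup G] [CompactSpace G],
    Nontrivial G → letI : MeasurableSpace G := borel G
    haveI : BorelSpace G := ⟨rfl⟩
    ∀ (r : LatticeRep G) (M : ℕ), 2 ≤ M → Window r M

/-- The weakenings are ordered (`WithoutSimple ⟹ Nontrivial-variant`); both are refuted, the
second only by genuine statistical mechanics (freezing), and the crux itself resists. -/
theorem tunedSequenceExistsNontrivial_of_withoutSimple (h : TunedSequenceExistsWithoutSimple) :
    TunedSequenceExistsNontrivial :=
  fun G _ _ _ _ _ => h G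

end FiniteGroups

/-! ## § Madic — block factors: `Window r (M^j) → Window r M` (gen 3)

An `M^j`-adic tuned scheme is an `M`-adic one (`n ↦ j·n`); so among the instances of the crux the
ones at perfect powers are the strong ones (`Window r 4 → Window r 2`, not conversely), and a
refutation at `M` refutes every `M^j`. -/

section Madic

variable {G : Type} [Group G] [TopologicalSpace G] [IsTopologicalGroup G] [CompactSpace G]
  [MeasurableSpace G] [BorelSpace G]

theorem window_of_window_pow (r : LatticeRep G) (M j : ℕ) (h : Window r (M ^ j)) : Window r M := by
  obtain ⟨θ₀, hθ₀, h⟩ := h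
  refine ⟨θ₀, hθ₀, fun θ hθ hθ' => ?_⟩
  obtain ⟨sch, n, hshape, hβ, hconv, hlim⟩ := h θ hθ hθ'
  have hcast : ∀ k, ((M ^ j : ℕ) : ℝ) ^ n k = (M : ℝ) ^ (j * n k) := fun k => by
    rw [Nat.cast_pow, ← pow_mul]
  have hnat : ∀ k, (M ^ j) ^ n k = M ^ (j * n k) := fun k => (pow_mul M j (n k)).symm
  refine ⟨sch, fun k => j * n k, fun k => by rw [hshape k, hcast], hβ, fun t ht => ?_, ?_⟩
  · obtain ⟨c, hc⟩ := hconv t ht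
    refine ⟨c, hc.congr fun k => ?_⟩
    simp only [hcast, hnat]
  · refine hlim.congr fun k => ?_
    simp only [hcast, hnat]

/-- Contrapositive: an empty window at `M` empties the window at every power `M^j`. -/
theorem not_window_pow (r : LatticeRep G) {M : ℕ} (j : ℕ) (h : ¬ Window r M) : ¬ Window r (M ^ j) :=
  fun h' => h (window_of_window_pow r M j h')

end Madic

/-! ## § Targets — the lead's stuck stubs

(none registered: payload `stuck_stubs = []`, `targets = []` at gen 2 cycle 1 and gen 3 cycle 2 —
no line picked yet; round-1 ideas `block-conditioned-covariance`, `transport-to-fixed-distance`,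
`dirichlet-box-localisation` are in triage.)

## § Resists — why (S) itself has no refutation in reach, and what a kill would need

**Shape of ¬(S).** By `tunedSequenceExists_iff`, ¬(S) needs ONE compact simple Lie `G`, one
faithful unitary `r` and one `M ≥ 2` with `¬ Window r M`, i.e. for every `θ₀ > 0` some
`θ ∈ (0, θ₀)` that is NOT a tuned limit. With the index set, the torus sizes `L_k` and the
couplings `β_k` all free (subject to `β_k → ∞`, `L_k / M^{n_k} → ∞`), and with β-continuity of the
finite-torus correlator plus the two endpoints `N_1(k, 0) = 0` (gen 1, exact) and
`N_1(k, β) → 0` (`β → ∞`, `latticeConnectedCorr_curvature_tendsto_zero`), the intermediate value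
theorem produces a witness as soon as the correlator is LARGE somewhere beyond every `B`:
(S) ⟸ `∃ θ₀ > 0, ∀ B, ∀ᶠ m, ∃ L ≫ M^m, ∃ β ≥ B, (M^m)^8 ⟨P ; τ_{M^m} P⟩_{β, 2L+1} ≥ θ₀`
(+ the a-priori bound of § ClauseThree). Hence a disproof of (S) must establish the NEGATION of
that window lower bound: a uniform weak-coupling UPPER bound
`sup_{β ≥ B} (M^m)^8 |⟨P ; τ_{M^m} P⟩_{β, 2L+1}| → 0` (`m → ∞`, all large `L`) for some `B` —
"at all sufficiently weak couplings the dimension-4 curvature correlator decays FASTER than its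
canonical power `D⁻⁸`, uniformly", i.e. the ABSENCE of any scaling window. This contradicts
asymptotic freedom / dimensional transmutation (the expected `Θ(ℓ) ≈ c_N g(ℓ)⁴ > 0` at physical
separation `ℓ`, covering `(0, θ_max]` twice, UV and IR branch) and no technique in print comes
near it: strong-coupling expansions (OS78) bound correlations from above only for `β < β₀`;
Bałaban's programme gives ultraviolet STABILITY (two-sided bounds on effective actions), not
correlation decay; the only rigorous `ξ(β) → ∞` results are abelian (`U(1)₄`, Guth /
Fröhlich–Spencer; barrier `AbelianDeconfinementD4`, where `D⁸ · corr → 0` anyway). Conversely a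
PROOF needs the quantitative `ξ(β) → ∞` (Chatterjee, arXiv:1803.01950, Problem 5.1; tree
`LatticeMassGapAllCouplings`, registered open). Verdict: (S) is physically robust and formally
open in both directions; it "resists because" its negation is a uniform triviality-type bound at
weak coupling that nobody can prove and nobody believes.

**Regimes tried (this file + gen 1).** `M ∈ {0, 1}` (killed: `not_window_zero/one`); trivial
group (killed: `not_window_of_subsingleton`); `β_k ≡ 0` and fixed small `β` (gen 1: exact
vanishing / OS clustering ⇒ no witness — the `β_k → ∞` clause is load-bearing from below);
`β_k → ∞` faster than any ceiling `b(n_k, L_k)` (killed: `not_windowDominating` — load-bearing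
from above); uniform scheme for two `θ` (gen 1: limits are unique); clause (iii) (neutral:
`window_iff_windowBdd`). Junk audits (g41-8, g40-0, g41-27, g41-25, gen 1): no Bochner junk
(probability measure, bounded integrands), no wrap-around (`eventually_sep_le_L`), `N ≥ 2` forced
by faithfulness + non-abelian, indiscrete/non-Hausdorff `G` excluded by the faithful continuous
representation. Gen 3: trivial representation (killed: `not_windowRho_one` — faithfulness
load-bearing); uniform weak-coupling clustering for ANY admissible datum (conditional kill =
contrapositive: `not_window_of_uniformClustering`); FINITE ABELIAN `G` (KILLED unconditionally:
`not_window_of_finite_abelian`, via the tree's contour expansion — the `Nontrivial` weakening of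
the crux is false; finite non-abelian `G` open for lack of a non-abelian expansion; `U(1)` open
for lack of spin-wave bounds, physically empty window as well); exponent `p ≥ 8` in place of `8` (implied by the crux:
`windowWeakPow_of_window`; `p < 8` not refutable without UV stability of `tr F²`); `β < 0` inside
`CorrMonotone` (unnecessary: `CorrMonotoneNonneg` suffices); block factors `M^j` versus `M`
(`window_of_window_pow`). Candidate compact simple data re-examined on paper: `SO(3)`, `G₂`,
`Sp(n)`, exceptional groups, reducible faithful `r` (fundamental ⊕ adjoint-heavy, `r ⊕ trivial^K`):
all asymptotically free with `b₀ = 11 C₂(G)/(48π²) > 0` for every non-abelian simple `𝔤`, constants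
in `P` drop out of connected correlators, Wilson measures of `r ⊕ trivial^K` coincide with those of
`r` — no candidate datum without a predicted scaling window.

**Why no `kit` computation (gen 3).** The only separations reachable by direct simulation are
`D = M^{n} ∈ {2, 4}` (`M = 2`) on tori `≤ 17⁴`. Tree level gives `N_1 = D⁸·Cov(P₀, P_D) ≈
(g⁴/16)·2·dim G·Σ_{planes}⟨F F⟩² ≈ 0.04·g⁴ ≈ 0.1` for `SU(2)` near `β ≈ 2.3`, i.e.
`Cov(P₀, P_D) ≈ θ/D⁸ ≈ 4·10⁻⁴` at `D = 2` and `≈ 2·10⁻⁶` at `D = 4`, against a Monte-Carlo noise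
floor `≈ 5·10⁻⁵` after `10⁴` sweeps of a `15⁴` lattice (the disconnected part `⟨P⟩² ≈ 60` must be
subtracted; the zero-momentum term `Var(P̄) ≈ 10⁻³` alone exceeds the `D = 4` signal). So `D = 4` is
out of reach without multilevel variance reduction, and `D ≤ 4` probes lattice artefacts, not the
window `D → ∞`: a simulation could neither support nor dent `CorrelatorWindowLowerBound`. Recorded so
that successors do not redo the estimate; a meaningful numerical test of the window lower bound is
the published glueball-correlator scaling literature (multilevel algorithms, physical volumes), not a session job.
All numbers in this paragraph are order-of-magnitude tree-level estimates, not measurements.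

**Warnings for provers.** (1) `0 ≤ N_t ≤ N_1` "by RP" is not available: the scheme's tori have
ODD side `2L_k + 1` (hard-coded in `SpeciesScheme.side`) while the tree's reflection positivity is
even-side, and `P` contains temporal plaquettes; § ClauseThree shows exactly a bound on `N_t`,
`t ≥ 2`, is what clause (iii) costs (`AprioriBound`). (2) The informal docstring's "for all large
`k` and every `B`" must be read `∀ B, ∀ᶠ k` — the other order is refuted at each fixed `k` by
`latticeConnectedCorr_curvature_tendsto_zero`. (3) `LatticeMassGapAllCouplings` as a hypothesis
does NOT literally suffice (infinite-volume `ξ`, no finite-torus amplitude): the usable input is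
the finite-volume window lower bound displayed above (gen 1's `CorrelatorWindowLowerBound`).
(4, gen 3) Restrict any transfer-operator argument to `β ≥ 0` (`CorrMonotoneNonneg`); the target
of a would-be DISproof is `UniformClustering r` for one admissible `(G, r)` (§ Clustering), the
target of a proof is `CorrelatorWindowLowerBound r M` + `CorrMonotoneNonneg r` (or any a-priori
bound on `N_t`, `t ≥ 2`). (5, gen 3) Clause (iii) rightly excludes `t = 0`: `N_0(k) =
(M^{n_k})^8 Var_{β_k}(P)` is expected to DIVERGE (`Var(P) ≍ β⁻²` at weak coupling while
`β_k ≍ log M^{n_k}`), so a variant of the crux with `∀ t : ℕ` (no `0 < t`) is physically false —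
not refuted here for lack of a volume-uniform LOWER bound on plaquette fluctuations.

**Barrier catalogue.** `FixedCouplingUltralocality` (evaded by design: `β_k → ∞`; instantiated by
gen 1 to kill fixed-β witnesses; gen 3's § Clustering is its uniform-in-`β ≥ β₁` form),
`UVStabilityNonUniqueness` (n/a to (S)), `DiscreteSubgroupFreezing` (excluded: `G` connected;
§ Clustering is the formal shape of how it would bite), `AbelianDeconfinementD4` (abelian only:
for `U(1)₄` the rescaled correlator tends to `c(β) ≈ c₀/β² → 0` along `β_k → ∞` — no dimensional
transmutation, window empty; excluded by non-abelianness).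
Negatives index (`ledger negatives --problem QuantumFields`): nothing on tuned Wilson sequences.
-/

end Summit.QuantumFields.YangMills.Cruxes.TunedSequenceExists.Disproof

end
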